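import Mathlib.MeasureTheory.Integral.IntervalIntegral.Basic
import Mathlib.Analysis.SpecialFunctions.Pow.NNReal
import Mathlib.Algebra.Order.Field.GeomSum
import Literature.NumberTheory.Sieve.RosserSieveMainTerm
import HarnessLib

/-!
# Rosser's sieve: the sums `T_n(D, P(z))`, their continuous models, and the reduction of the
main-term estimate to Iwaniec's Lemmas 18 and 20

Topic `Literature/NumberTheory/Sieve`; third file on Iwaniec, *Rosser's sieve*, Acta Arith. 36
(1980) 171–202, after `SieveFunctions.lean` (the functions `F_κ, f_κ`, Theorem 1 as the named facts
`Iwaniec1980_thm1_lower/upper`) and `RosserSieveMainTerm.lean` (the analytic half of Theorem 1 as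
the named facts `Iwaniec1980_mainTerm_lower/upper`, and Theorem 1 PROVED from them). Here the
analytic half is decomposed further, following §4 and §§7–9 of the paper:

* **§4, proved.** With `T_n(D, P) = ∑_{t ∣ P, ν(t) = n} χ̄(t) g(t) V(P; q(t))` (`BetaSieve.bdrySum`;
  Iwaniec's `S^±_{r,z}(s)`, Greaves' `T_n(D, P(z))`, (4.1.1.4)) the main terms are
  `S⁺ = V(P) + ∑_n T⁺_n`, `S⁻ = V(P) − ∑_n T⁻_n` ((4.1)–(4.2): `BetaSieve.mainSum_one_eq`,
  `mainSum_zero_eq`, from the main-term identity of `SieveFrameworkFundamentalLemma.lean` and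
  `μ(t) = (−1)^{par}` on the boundary); the terms of the wrong parity vanish; peeling off the
  LARGEST prime factor (`BetaSieve.pred_mul_of_lt`, `bdry_mul_of_lt`: Greaves (4.1.1.5)–(4.1.1.6))
  and grouping the divisors of `P(z)` by their largest prime
  (`BetaSieve.sum_divisors_primesProdBelow`) give the recurrences (4.3)–(4.5)
  (`BetaSieve.bdrySum_one_eq`, `bdrySum_succ_succ`; Greaves Lemma 4.1.1).
* **§7, defined.** The continuous models `S_n(s)` of (7.1) (`BetaSieve.contS κ β n s`; Greaves'
  `s^κ f_n(s)`, (4.1.3.1)–(4.1.3.2)) and the partial sums `T^±_R(s)` of (7.1)–(7.2)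
  (`BetaSieve.contT`), with support, nonnegativity and the third line of (7.3) proved
  (`contS_eq_zero_of_le`, `contS_nonneg`, `contT_one_eq_of_le`); the discrete partial sums
  `T^±_{R,z}(s)` (`BetaSieve.discT`).
* **§8, (8.4)/(9.2), proved** in qualitative form: in the range `log z ≤ s⁵⁰` the boundary sums are
  `≤ C(κ, β, L) V(z) (log y)^{−1/3}` (`BetaSieve.discT_le_of_log_le_pow`, by Rankin's trick).
* **Lemma 18 and Lemma 20, named facts** on their printed ranges (`Iwaniec1980_lemma18`:
  `T⁺_R(s) ≤ T⁺(s) = s^κ (F(s) − 1)` for `s ≥ β + 1`, `T⁻_R(s) ≤ s^κ (1 − f(s))` for `s ≥ β`, for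
  Iwaniec's = the greatest `β`-sieve data; `Iwaniec1980_lemma20` in the form (9.1):
  `T^±_{R,z}(s) ≤ V(z) s^{−κ} (T^±_R(s) + C (log y)^{−1/3})` for `s > β − (1±1)/2`,
  `s⁵⁰ ≤ log z`), with the PROVED consequences `Iwaniec1980_lemma18.upper_of_pos` (the `+`
  inequality on `(0, β + 1]` by (7.3) and (1.8)), `.one_le_upper`, `.lower_le_one`, and
  `IsBetaSieveSolution.lower_nonneg_of_mem_Icc` (`f ≥ 0` on `[β, β + 2]` from (1.8)–(1.9)).
* **§9, proved.** `Iwaniec1980_mainTerm_lower_of`, `Iwaniec1980_mainTerm_upper_of`: the main-term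
  estimates, hence Theorem 1 and `SieveSequence.Iwaniec1980_lower/upper`, follow from
  `exists_isGreatestBetaSieveData`, `Iwaniec1980_lemma18` and `Iwaniec1980_lemma20`; the endpoints
  `s = β`, `s = β − 1` not covered by the strict ranges of Lemma 20 are reached by shrinking `z`
  without changing `P(z)` (`exists_lt_primesProdBelow_eq`).

What remains for a full proof of Theorem 1 is thus: the existence of the greatest `β`-sieve data
together with Iwaniec's series representation (§§5–7: the adjoint functions `g, h`, the majorants
`Q^±` of §6, Lemmas 17–18), and Lemma 20 (§8, an induction on `R` using Lemma 21 = partial summation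
under `Ω(κ, L)`, the recurrences (4.3)–(4.6) proved here, (7.3)–(7.5) and (8.3)–(8.14)).

## References

* H. Iwaniec, *Rosser's sieve*, Acta Arith. 36 (1980), 171–202: §4 ((4.1)–(4.6)), §7 ((7.1)–(7.3),
  (7.7), Lemma 18), §8 (Lemma 20, (8.1), (8.4)), §9 ((9.1)–(9.2), p. 202). [IwaniecActaArith1980]
* G. Greaves, *Sieves in Number Theory*, Springer (2001), §4.1.1 ((1.1)–(1.11), Lemma 1), §4.1.3
  ((3.1)–(3.2)), Prop. 4.2.1, §4.2.4 (4.10). [Greaves2001]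

## Design notes

* `BetaSieve.pred` (Rosser's set) is defined by recursion on the LEAST prime factor, whereas the
  recurrences of §4 peel off the LARGEST one; `pred_mul_of_lt` bridges the two (induction along the
  recursion), with the parity flip `par ↦ par + 1` and the level change `D ↦ D/p` of Greaves
  (4.1.1.6).
* `contS` is indexed by the number `n` of primes (odd `n = 2r + 1 ↔ S⁺_r`, even `n = 2r ↔ S⁻_r`),
  with lower limit `max(s, β + ε_n)` (constant continuation below `β + ε_n`; for odd `n` this is
  (7.1), fourth line, for even `n` the values below `β` are never used) and upper limit `β + n` (the
  support of `S_{n−1}(t − 1)`), so that no improper integral occurs. Only `s ≥ β − ε_n`, `s > 0` is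
  meaningful.
* The named facts quantify over greatest `β`-sieve data `B` (so `β = β_κ`); they are vacuous if no
  such data exist and become unconditional inputs together with `exists_isGreatestBetaSieveData`.
-/

open Finset Filter Asymptotics
open scoped ArithmeticFunction.Moebius ArithmeticFunction.omega

noncomputable section

namespace Literature.NumberTheory.Sieve

namespace BetaSieve

variable {par : ℕ} {β D : ℝ}

/-! ### Peeling off the largest prime factor -/

/-- If all prime factors of `e ≠ 0` are `< p` (`p` prime), then `p ∤ e`. [folklore] -/
theorem not_dvd_of_primeFactors_lt {p e : ℕ} (hp : p.Prime) (he0 : e ≠ 0)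
    (hlt : ∀ q ∈ e.primeFactors, q < p) : ¬ p ∣ e := fun h =>
  lt_irrefl p (hlt p (Nat.mem_primeFactors.mpr ⟨hp, h, he0⟩))

/-- If all prime factors of `e ∉ {0, 1}` are `< p` (`p` prime), then `q(p e) = q(e)`
(`q` = least prime factor). [folklore] -/
theorem minFac_mul_of_lt {p e : ℕ} (hp : p.Prime) (he0 : e ≠ 0) (he1 : e ≠ 1)
    (hlt : ∀ q ∈ e.primeFactors, q < p) : (p * e).minFac = e.minFac := by
  have hq := Nat.minFac_prime he1
  have hpe1 : p * e ≠ 1 := fun h => hp.ne_one (Nat.eq_one_of_mul_eq_one_right h)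
  have hr := Nat.minFac_prime hpe1
  apply le_antisymm
  · exact Nat.minFac_le_of_dvd hq.two_le ((Nat.minFac_dvd e).trans (dvd_mul_left e p))
  · rcases (Nat.Prime.dvd_mul hr).mp (Nat.minFac_dvd (p * e)) with h | h
    · have hrp : (p * e).minFac = p := (Nat.prime_dvd_prime_iff_eq hr hp).mp h
      rw [hrp]
      exact (hlt _ (Nat.mem_primeFactors.mpr ⟨hq, Nat.minFac_dvd e, he0⟩)).le
    · exact Nat.minFac_le_of_dvd hr.two_le h

/-- In the situation of `minFac_mul_of_lt`, `(p e) / q(p e) = p (e / q(e))`. [folklore] -/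
theorem mul_div_minFac_of_lt {p e : ℕ} (hp : p.Prime) (he0 : e ≠ 0) (he1 : e ≠ 1)
    (hlt : ∀ q ∈ e.primeFactors, q < p) : p * e / (p * e).minFac = p * (e / e.minFac) := by
  rw [minFac_mul_of_lt hp he0 he1 hlt, Nat.mul_div_assoc p (Nat.minFac_dvd e)]

/-- `ν(p e) = ν(e) + 1` for a prime `p` above the prime factors of `e ≠ 0`. [folklore] -/
theorem card_primeFactors_mul_of_lt {p e : ℕ} (hp : p.Prime) (he0 : e ≠ 0)
    (hlt : ∀ q ∈ e.primeFactors, q < p) : (p * e).primeFactors.card = e.primeFactors.card + 1 := by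
  rw [mul_comm]
  exact card_primeFactors_mul_prime hp he0 (not_dvd_of_primeFactors_lt hp he0 hlt)

/-- **Peeling off the largest prime** (Greaves, *Sieves in Number Theory*, (4.1.1.6):
`χ⁻_D(p₁ ⋯ p_n) = χ⁺_{D/p₁}(p₂ ⋯ p_n)`, `χ⁺_D(p₁ ⋯ p_n) = χ⁻_{D/p₁}(p₂ ⋯ p_n)` if `p₁^{β+1} < D`,
`= 0` otherwise): for a prime `p` exceeding all prime factors of `e ≠ 0`,
`χ^{par}_D(p e) = 1 ↔ (par odd → p^{β+1} < D) ∧ χ^{par+1}_{D/p}(e) = 1`.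
[cite: Greaves2001, §4.1.1 (1.6)] -/
theorem pred_mul_of_lt {p e : ℕ} (hp : p.Prime) (he0 : e ≠ 0)
    (hlt : ∀ q ∈ e.primeFactors, q < p) :
    pred par β D (p * e) ↔
      (par % 2 = 1 → (p : ℝ) ^ (β + 1) < D) ∧ pred (par + 1) β (D / p) e := by
  induction e using Nat.strong_induction_on generalizing par with
  | _ e ih =>
    have hp0 : (0 : ℝ) < p := by exact_mod_cast hp.pos
    by_cases he1 : e = 1
    · subst he1
      rw [mul_one, pred_iff hp.one_lt, hp.minFac_eq, Nat.div_self hp.pos, hp.primeFactors,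
        Finset.card_singleton, Real.rpow_add_one hp0.ne' β]
      simp only [pred_one, true_and, and_true]
      constructor
      · intro h hpar; rw [mul_comm]; exact h (by omega)
      · intro h hpar; rw [mul_comm]; exact h (by omega)
    · have hq := Nat.minFac_prime he1
      have he' : e / e.minFac ≠ 0 :=
        (Nat.div_pos (Nat.minFac_le (Nat.pos_of_ne_zero he0)) hq.pos).ne'
      have hlt' : ∀ q ∈ (e / e.minFac).primeFactors, q < p := fun q hq' =>
        hlt q (Nat.primeFactors_mono (Nat.div_dvd_of_dvd (Nat.minFac_dvd e)) he0 hq')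
      have hlt_e : e / e.minFac < e := Nat.div_lt_self (Nat.pos_of_ne_zero he0) hq.one_lt
      have h1e : 1 < e := lt_of_le_of_ne (Nat.one_le_iff_ne_zero.mpr he0) (Ne.symm he1)
      have h1pe : 1 < p * e := lt_of_lt_of_le h1e (Nat.le_mul_of_pos_left e hp.pos)
      rw [pred_iff h1pe, mul_div_minFac_of_lt hp he0 he1 hlt, minFac_mul_of_lt hp he0 he1 hlt,
        ih _ hlt_e he' hlt', pred_iff (par := par + 1) h1e, card_primeFactors_mul_of_lt hp he0 hlt]
      have e1 : ((e.primeFactors.card + 1) % 2 = par % 2) ↔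
          (e.primeFactors.card % 2 = (par + 1) % 2) := by omega
      have e2 : (((p * e : ℕ) : ℝ) * (e.minFac : ℝ) ^ β < D) ↔
          ((e : ℝ) * (e.minFac : ℝ) ^ β < D / p) := by
        rw [lt_div_iff₀ hp0, Nat.cast_mul]
        constructor <;> intro h <;> nlinarith [h]
      rw [e1, e2]
      tauto

/-- The case `e = 1` of the peeling: `χ^{par}_D(p) = 1 ↔ (par odd → p^{β+1} < D)`. [folklore] -/
theorem pred_prime_iff {p : ℕ} (hp : p.Prime) :
    pred par β D p ↔ (par % 2 = 1 → (p : ℝ) ^ (β + 1) < D) := by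
  have h := pred_mul_of_lt (par := par) (β := β) (D := D) (e := 1) hp one_ne_zero (by simp)
  rw [mul_one] at h
  rw [h]
  simp [pred_one]

/-- The boundary indicator under peeling (Greaves (4.1.1.5)): for `e ∉ {0, 1}` with prime factors
`< p`, `χ̄^{par}_D(p e) = [par odd → p^{β+1} < D] · χ̄^{par+1}_{D/p}(e)`.
[cite: Greaves2001, §4.1.1 (1.5)] -/
theorem bdry_mul_of_lt {p e : ℕ} (hp : p.Prime) (he0 : e ≠ 0) (he1 : e ≠ 1)
    (hlt : ∀ q ∈ e.primeFactors, q < p) :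
    bdry par β D (p * e) =
      (if (par % 2 = 1 → (p : ℝ) ^ (β + 1) < D) then 1 else 0) * bdry (par + 1) β (D / p) e := by
  classical
  have hq := Nat.minFac_prime he1
  have he' : e / e.minFac ≠ 0 :=
    (Nat.div_pos (Nat.minFac_le (Nat.pos_of_ne_zero he0)) hq.pos).ne'
  have hlt' : ∀ q ∈ (e / e.minFac).primeFactors, q < p := fun q hq' =>
    hlt q (Nat.primeFactors_mono (Nat.div_dvd_of_dvd (Nat.minFac_dvd e)) he0 hq')
  unfold bdry
  rw [mul_div_minFac_of_lt hp he0 he1 hlt, pred_mul_of_lt hp he' hlt', pred_mul_of_lt hp he0 hlt]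
  by_cases hC : (par % 2 = 1 → (p : ℝ) ^ (β + 1) < D)
  · rw [if_pos hC, one_mul]
    simp only [and_iff_right hC]
  · rw [if_neg hC, zero_mul, if_neg]
    rintro ⟨⟨hc, -⟩, -⟩
    exact hC hc

/-- The boundary indicator at a prime (Greaves (4.1.1.5), last line):
`χ̄^{par}_D(p) = [par odd ∧ p^{β+1} ≥ D]`. [cite: Greaves2001, §4.1.1 (1.5)] -/
theorem bdry_prime {p : ℕ} (hp : p.Prime) :
    bdry par β D p = if par % 2 = 1 ∧ D ≤ (p : ℝ) ^ (β + 1) then 1 else 0 := by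
  classical
  unfold bdry
  rw [hp.minFac_eq, Nat.div_self hp.pos, pred_prime_iff hp]
  by_cases h1 : par % 2 = 1
  · by_cases h2 : D ≤ (p : ℝ) ^ (β + 1)
    · rw [if_pos ⟨pred_one, fun h => absurd (h h1) (not_lt.mpr h2)⟩, if_pos ⟨h1, h2⟩]
    · rw [if_neg, if_neg (fun h => h2 h.2)]
      exact fun h => h.2 fun _ => not_le.mp h2
  · rw [if_neg, if_neg (fun h => h1 h.1)]
    exact fun h => h.2 fun h' => absurd h' h1

/-- If `χ̄(t) ≠ 0` then `t ≠ 1`, `ν(t) ≡ par (mod 2)` and the top truncation condition fails: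
`D ≤ t · q(t)^β`. [folklore] -/
theorem of_bdry_ne_zero {t : ℕ} (h : bdry par β D t ≠ 0) :
    t ≠ 1 ∧ t.primeFactors.card % 2 = par % 2 ∧ D ≤ (t : ℝ) * (t.minFac : ℝ) ^ β := by
  classical
  unfold bdry at h
  rw [Ne, ite_eq_right_iff, Classical.not_imp] at h
  obtain ⟨⟨h1, h2⟩, -⟩ := h
  have ht1 : t ≠ 1 := fun ht => h2 (pred_of_le_one ht.le)
  have ht0 : t ≠ 0 := fun ht => h2 (pred_of_le_one (by omega))
  rw [pred_iff (lt_of_le_of_ne (Nat.one_le_iff_ne_zero.mpr ht0) (Ne.symm ht1))] at h2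
  by_cases hpar : t.primeFactors.card % 2 = par % 2
  · refine ⟨ht1, hpar, ?_⟩
    by_contra hlt
    exact h2 ⟨h1, fun _ => not_le.mp hlt⟩
  · exact absurd ⟨h1, fun h => absurd h hpar⟩ h2

/-- On the boundary `μ(t) = (−1)^{par}` (`ν(t) ≡ par`): `μ(t) χ̄(t) = (−1)^{par} χ̄(t)` for
squarefree `t`. [folklore] -/
theorem moebius_mul_bdry {t : ℕ} (ht : Squarefree t) :
    (μ t : ℝ) * bdry par β D t = (-1) ^ par * bdry par β D t := by
  by_cases h : bdry par β D t = 0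
  · rw [h, mul_zero, mul_zero]
  · obtain ⟨-, hpar, -⟩ := of_bdry_ne_zero h
    rw [moebius_of_squarefree ht, neg_one_pow_eq_pow_mod_two, hpar, ← neg_one_pow_eq_pow_mod_two]

/-! ### Divisors of `P(z)` by their largest prime factor -/

/-- `P(p) = ∏_{q < p} q` for a natural number `p` (no ceiling). [folklore] -/
theorem primesProdBelow_natCast (p : ℕ) : primesProdBelow (p : ℝ) = ∏ q ∈ Nat.primesBelow p, q := by
  rw [primesProdBelow, Nat.ceil_natCast]

/-- Grouping the divisors `t > 1` of `∏_{p < N} p` by their largest prime factor `p`: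
`t = p e` with `e ∣ ∏_{q < p} q`. [folklore] -/
theorem sum_divisors_prod_primesBelow (Φ : ℕ → ℝ) (N : ℕ) :
    ∑ t ∈ (∏ p ∈ Nat.primesBelow N, p).divisors, Φ t =
      Φ 1 + ∑ p ∈ Nat.primesBelow N, ∑ e ∈ (∏ q ∈ Nat.primesBelow p, q).divisors, Φ (p * e) := by
  induction N with
  | zero => simp
  | succ N ih =>
    rw [Nat.primesBelow_succ]
    split_ifs with hN
    · have hnot : N ∉ Nat.primesBelow N := Nat.notMem_primesBelow N
      have hndvd : ¬ N ∣ ∏ p ∈ Nat.primesBelow N, p := by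
        rw [Prime.dvd_finsetProd_iff hN.prime]
        rintro ⟨q, hq, hdvd⟩
        have hqp := Nat.prime_of_mem_primesBelow hq
        have := (Nat.prime_dvd_prime_iff_eq hN hqp).mp hdvd
        exact hnot (this ▸ hq)
      rw [Finset.prod_insert hnot, mul_comm, sum_divisors_mul_prime hN hndvd, ih,
        Finset.sum_insert hnot]
      simp only [mul_comm _ N]
      ring
    · exact ih

/-- Grouping the divisors `t > 1` of `P(z)` by their largest prime factor:
`∑_{t ∣ P(z)} Φ(t) = Φ(1) + ∑_{p < z} ∑_{e ∣ P(p)} Φ(p e)`. [folklore] -/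
theorem sum_divisors_primesProdBelow (Φ : ℕ → ℝ) (z : ℝ) :
    ∑ t ∈ (primesProdBelow z).divisors, Φ t =
      Φ 1 + ∑ p ∈ Nat.primesBelow ⌈z⌉₊, ∑ e ∈ (primesProdBelow p).divisors, Φ (p * e) := by
  refine (sum_divisors_prod_primesBelow Φ ⌈z⌉₊).trans ?_
  congr 1
  refine Finset.sum_congr rfl fun p _ => ?_
  rw [primesProdBelow_natCast]

/-- Facts about a divisor `e` of `P(p)`, `p` prime: `e ≠ 0`, squarefree, prime factors `< p`.
[folklore] -/
theorem of_mem_divisors_primesProdBelow {p e : ℕ} (he : e ∈ (primesProdBelow p).divisors) :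
    e ≠ 0 ∧ Squarefree e ∧ ∀ q ∈ e.primeFactors, q < p := by
  have hdvd := Nat.dvd_of_mem_divisors he
  refine ⟨fun h => primesProdBelow_ne_zero _ (Nat.eq_zero_of_zero_dvd (h ▸ hdvd)),
    (squarefree_primesProdBelow _).squarefree_of_dvd hdvd, fun q hq => ?_⟩
  exact_mod_cast prime_lt_of_mem_primeFactors_of_dvd hdvd hq

variable {g : ArithmeticFunction ℝ}

/-- `V(P(w); q) = V(P(q))` for `q ≤ w`: the prime factors of `P(w)` below `q` are the primes below
`q`. [folklore] -/
theorem vlt_primesProdBelow_eq_vprod {q : ℕ} {w : ℝ} (hq : (q : ℝ) ≤ w) :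
    vlt g (primesProdBelow w) q = vprod g (primesProdBelow q) := by
  rw [vlt, vprod, primeFactors_primesProdBelow, primeFactors_primesProdBelow, Nat.ceil_natCast]
  refine Finset.prod_congr ?_ fun _ _ => rfl
  ext r
  simp only [Finset.mem_filter, Nat.mem_primesBelow, Nat.lt_ceil]
  constructor
  · rintro ⟨⟨-, hr⟩, hrq⟩; exact ⟨hrq, hr⟩
  · rintro ⟨hrq, hr⟩
    exact ⟨⟨lt_of_lt_of_le (by exact_mod_cast hrq) hq, hr⟩, hrq⟩

/-! ### The sums `T_n(D, P)` (Iwaniec's `S^±_{r,z}`, Greaves' `T_n(D, P(z))`) -/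

/-- `BetaSieve.bdrySum par g β D P n = T_n(D, P) = ∑_{t ∣ P, ν(t) = n} χ̄^{par}_D(t) g(t) V(P; q(t))`,
the contribution of the boundary terms with exactly `n` prime factors to the main term of
the `β`-sieve of parity `par` (Greaves, *Sieves in Number Theory*, (4.1.1.4); for `P = P(z)` and
`n = 2r + 1` (`par = 1`), resp. `n = 2r` (`par = 0`), this is Iwaniec's `S⁺_{r,z}(s)`, resp.
`S⁻_{r,z}(s)`,
*Rosser's sieve*, (4.1)–(4.2), since `V(P(z); q(t)) = V(p_n) = ∏_{p < p_n} (1 − g(p))`).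
[cite: Greaves2001, §4.1.1 (1.4)] -/
def bdrySum (par : ℕ) (g : ArithmeticFunction ℝ) (β D : ℝ) (P n : ℕ) : ℝ :=
  ∑ t ∈ P.divisors with t.primeFactors.card = n, bdry par β D t * g t * vlt g P t.minFac

/-- Unfolding lemma for `bdrySum`. [folklore] -/
theorem bdrySum_def (par : ℕ) (g : ArithmeticFunction ℝ) (β D : ℝ) (P n : ℕ) :
    bdrySum par g β D P n =
      ∑ t ∈ P.divisors with t.primeFactors.card = n, bdry par β D t * g t * vlt g P t.minFac :=
  rfl

/-- `T_0 = 0` (`χ̄(1) = 0`). [folklore] -/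
theorem bdrySum_zero (par : ℕ) (g : ArithmeticFunction ℝ) (β D : ℝ) {P : ℕ} (hP : P ≠ 0) :
    bdrySum par g β D P 0 = 0 := by
  refine Finset.sum_eq_zero fun t ht => ?_
  rw [Finset.mem_filter, Finset.card_eq_zero, Nat.primeFactors_eq_empty] at ht
  rcases ht.2 with h | h
  · exact absurd (Nat.mem_divisors.mp (h ▸ ht.1)).1 (by simp [hP])
  · rw [h, bdry_one, zero_mul, zero_mul]

/-- `T_n^{par} = 0` unless `n ≡ par (mod 2)` (the boundary terms have `ν(t) ≡ par`). [folklore] -/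
theorem bdrySum_eq_zero_of_mod_two_ne (g : ArithmeticFunction ℝ) (β D : ℝ) (P : ℕ) {par n : ℕ}
    (h : n % 2 ≠ par % 2) : bdrySum par g β D P n = 0 := by
  refine Finset.sum_eq_zero fun t ht => ?_
  rw [Finset.mem_filter] at ht
  by_cases hb : bdry par β D t = 0
  · rw [hb, zero_mul, zero_mul]
  · exact absurd (ht.2 ▸ (of_bdry_ne_zero hb).2.1) h

/-- **Iwaniec (4.1)–(4.2) / Greaves (4.1.1.1)–(4.1.1.3)**: the main term of the `β`-sieve is
`V(P) − (−1)^{par} ∑_n T_n(D, P)`, i.e. `S⁺ = V(P) + ∑_{n odd} T_n`, `S⁻ = V(P) − ∑_{n even} T_n`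
(from the main-term identity `BetaSieve.mainTerm_identity` and `μ(t) = (−1)^{par}` on the boundary).
[cite: IwaniecActaArith1980, (4.1)–(4.2)] -/
theorem mainSum_eq_vprod_sub (hg : g.IsMultiplicative) {P : ℕ} (hP : Squarefree P) (par : ℕ)
    (β D : ℝ) :
    mainSum par g β D P =
      vprod g P -
        (-1) ^ par * ∑ n ∈ Finset.range (P.primeFactors.card + 1), bdrySum par g β D P n := by
  rw [mainSum, mainTerm_identity hg hP]
  congr 1
  have hmaps : ∀ t ∈ P.divisors, (fun t : ℕ => t.primeFactors.card) t ∈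
      Finset.range (P.primeFactors.card + 1) := by
    intro t ht
    have := Nat.primeFactors_mono (Nat.dvd_of_mem_divisors ht) hP.ne_zero
    exact Finset.mem_range.mpr (Nat.lt_succ_of_le (Finset.card_le_card this))
  rw [← Finset.sum_fiberwise_of_maps_to hmaps, Finset.mul_sum]
  refine Finset.sum_congr rfl fun n _ => ?_
  rw [bdrySum, Finset.mul_sum]
  refine Finset.sum_congr rfl fun t ht => ?_
  have hts := hP.squarefree_of_dvd (Nat.dvd_of_mem_divisors (Finset.mem_filter.mp ht).1)
  linear_combination (g t * vlt g P t.minFac) * moebius_mul_bdry (par := par) (β := β) (D := D) hts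

/-- Upper sieve: `S⁺(D, P) = V(P) + ∑_n T⁺_n(D, P)`. [cite: IwaniecActaArith1980, (4.1)] -/
theorem mainSum_one_eq (hg : g.IsMultiplicative) {P : ℕ} (hP : Squarefree P) (β D : ℝ) :
    mainSum 1 g β D P =
      vprod g P + ∑ n ∈ Finset.range (P.primeFactors.card + 1), bdrySum 1 g β D P n := by
  rw [mainSum_eq_vprod_sub hg hP]; ring

/-- Lower sieve: `S⁻(D, P) = V(P) − ∑_n T⁻_n(D, P)`. [cite: IwaniecActaArith1980, (4.2)] -/
theorem mainSum_zero_eq (hg : g.IsMultiplicative) {P : ℕ} (hP : Squarefree P) (β D : ℝ) :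
    mainSum 0 g β D P =
      vprod g P - ∑ n ∈ Finset.range (P.primeFactors.card + 1), bdrySum 0 g β D P n := by
  rw [mainSum_eq_vprod_sub hg hP]; ring

/-- **Recurrence for `T_n`, `n ≥ 2`** (Iwaniec (4.4)–(4.5); Greaves Lemma 4.1.1, (1.10)–(1.11), in
the unrestricted form):
`T^{par}_{n+1}(D, P(z)) = ∑_{p < z, [par odd → p^{β+1} < D]} g(p) T^{par+1}_n(D/p, P(p))` for `n ≥ 1`.
(The printed ranges `y^{1/(β+n+1)} ≤ p < min(z, y^{1/(β+ε)})`
only discard vanishing terms.) [cite: IwaniecActaArith1980, (4.4)–(4.5)] -/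
theorem bdrySum_succ_succ (hg : g.IsMultiplicative) (par : ℕ) (β D z : ℝ) (n : ℕ) :
    bdrySum par g β D (primesProdBelow z) (n + 2) =
      ∑ p ∈ Nat.primesBelow ⌈z⌉₊, (if (par % 2 = 1 → (p : ℝ) ^ (β + 1) < D) then g p else 0) *
        bdrySum (par + 1) g β (D / p) (primesProdBelow p) (n + 1) := by
  classical
  rw [bdrySum, Finset.sum_filter, sum_divisors_primesProdBelow]
  rw [Nat.primeFactors_one, Finset.card_empty, if_neg (by omega : (0 : ℕ) ≠ n + 2), zero_add]
  refine Finset.sum_congr rfl fun p hp => ?_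
  have hpp := Nat.prime_of_mem_primesBelow hp
  have hpz : (p : ℝ) ≤ z := (Nat.lt_ceil.mp (Nat.lt_of_mem_primesBelow hp)).le
  rw [bdrySum, Finset.sum_filter, Finset.mul_sum]
  refine Finset.sum_congr rfl fun e he => ?_
  obtain ⟨he0, hesq, hlt⟩ := of_mem_divisors_primesProdBelow he
  rw [card_primeFactors_mul_of_lt hpp he0 hlt]
  by_cases hcard : e.primeFactors.card = n + 1
  · have he1 : e ≠ 1 := by rintro rfl; simp at hcard
    have hq := Nat.minFac_prime he1
    have hqp : e.minFac < p := hlt _ (Nat.mem_primeFactors.mpr ⟨hq, Nat.minFac_dvd e, he0⟩)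
    have hqp' : ((e.minFac : ℕ) : ℝ) ≤ (p : ℝ) := by exact_mod_cast hqp.le
    have hcop : Nat.Coprime p e :=
      hpp.coprime_iff_not_dvd.mpr (not_dvd_of_primeFactors_lt hpp he0 hlt)
    rw [if_pos (by rw [hcard]), if_pos hcard, bdry_mul_of_lt hpp he0 he1 hlt,
      hg.map_mul_of_coprime hcop, minFac_mul_of_lt hpp he0 he1 hlt,
      vlt_primesProdBelow_eq_vprod (hqp'.trans hpz), vlt_primesProdBelow_eq_vprod hqp']
    split_ifs <;> ring
  · rw [if_neg (by omega), if_neg hcard, mul_zero]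

/-- **The first sum** (Iwaniec (4.3); Greaves Lemma 4.1.1, (1.9)): `T⁻_1 = 0` and
`T⁺_1(D, P(z)) = ∑_{p < z, p^{β+1} ≥ D} g(p) V(P(p))`. [cite: IwaniecActaArith1980, (4.3)] -/
theorem bdrySum_one_eq (par : ℕ) (β D z : ℝ) :
    bdrySum par g β D (primesProdBelow z) 1 =
      ∑ p ∈ Nat.primesBelow ⌈z⌉₊,
        if par % 2 = 1 ∧ D ≤ (p : ℝ) ^ (β + 1) then g p * vprod g (primesProdBelow p) else 0 := by
  classical
  rw [bdrySum, Finset.sum_filter, sum_divisors_primesProdBelow]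
  rw [Nat.primeFactors_one, Finset.card_empty, if_neg (by omega : (0 : ℕ) ≠ 1), zero_add]
  refine Finset.sum_congr rfl fun p hp => ?_
  have hpp := Nat.prime_of_mem_primesBelow hp
  have hpz : (p : ℝ) ≤ z := (Nat.lt_ceil.mp (Nat.lt_of_mem_primesBelow hp)).le
  rw [Finset.sum_eq_single_of_mem 1 (Nat.one_mem_divisors.mpr (primesProdBelow_ne_zero _))]
  · rw [mul_one, hpp.primeFactors, Finset.card_singleton, if_pos rfl, bdry_prime hpp, hpp.minFac_eq,
      vlt_primesProdBelow_eq_vprod hpz]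
    split_ifs <;> ring
  · intro e he he1
    obtain ⟨he0, -, hlt⟩ := of_mem_divisors_primesProdBelow he
    rw [card_primeFactors_mul_of_lt hpp he0 hlt, if_neg]
    have : e.primeFactors.card ≠ 0 := fun h0 => by
      rcases Nat.primeFactors_eq_empty.mp (Finset.card_eq_zero.mp h0) with h | h
      · exact he0 h
      · exact he1 h
    omega

/-! ### The continuous models `S_n(s)` (Iwaniec §7, (7.1)–(7.3); Greaves (4.1.3.1)–(4.1.3.2)) -/

/-- Greaves' parity offset `ε_n` ((4.1.1.7)): `1` for odd `n`, `0` for even `n`; the sums of index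
`n` are studied for `s ≥ β − ε_n` and their continuous models are constant on `s ≤ β + ε_n`.
[cite: Greaves2001, §4.1.1 (1.7)] -/
def parityShift (n : ℕ) : ℝ := if n % 2 = 1 then 1 else 0

/-- `parityShift n = 1` for odd `n`. [folklore] -/
theorem parityShift_of_odd {n : ℕ} (h : n % 2 = 1) : parityShift n = 1 := if_pos h

/-- `parityShift n = 0` for even `n`. [folklore] -/
theorem parityShift_of_even {n : ℕ} (h : n % 2 = 0) : parityShift n = 0 :=
  if_neg (by omega)

/-- `0 ≤ parityShift n ≤ 1`. [folklore] -/
theorem parityShift_mem (n : ℕ) : parityShift n ∈ Set.Icc (0 : ℝ) 1 := by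
  unfold parityShift; split_ifs <;> exact ⟨by norm_num, by norm_num⟩

/-- `BetaSieve.contS κ β n s = S_n(s)`, the continuous model of `T_n(y, P(z))/V(z)`
(`s = log y/log z`) for Rosser's sieve with parameter `β` in dimension `κ`, defined by Iwaniec's
recurrences
(*Rosser's sieve*, §7, (7.1), with `n = 2r + 1 ↔ S⁺_r`, `n = 2r ↔ S⁻_r`):
`S_1(s) = (β + 1)^κ − s^κ` for `s ≤ β + 1` (and `0` beyond),
`S_n(s) = ∫_{max(s, β+ε_n)}^{β+n} κ t^{κ−1} (t − 1)^{−κ} S_{n−1}(t − 1) dt` for `n ≥ 2`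
(`= ∫_s^∞ (t − 1)^{−κ} S_{n−1}(t − 1) dt^κ` for `s ≥ β + ε_n`, since `S_{n−1}(t − 1) = 0` for
`t ≥ β + n`; continued as a constant below `β + ε_n`: for odd `n` this is (7.1), fourth line —
printed as "`S⁺_R(s) = S⁺_0(β + 1)` for `β − 1 < s ≤ β + 1`", a misprint for `S⁺_R(β + 1)`
(`S⁺_0(β + 1) = 0` would contradict the third line of (7.3) and the continuity asserted on p. 193;
Greaves (4.1.3.2) has the intended constant continuation) — while for even `n` the values below `β`
are never used). Equivalently
`S_n(s) = s^κ f_n(s)` with Greaves' `f_n` (*Sieves in Number Theory*, (4.1.3.1)–(4.1.3.2)). Index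
`0` is unused (`S_0 = 0`). Only the values for `s ≥ β − ε_n`, `s > 0` are meaningful.
[cite: IwaniecActaArith1980, §7 (7.1)] -/
def contS (κ β : ℝ) : ℕ → ℝ → ℝ
  | 0, _ => 0
  | 1, s => (β + 1) ^ κ - (min s (β + 1)) ^ κ
  | n + 2, s =>
      ∫ t in (max s (β + parityShift n))..(max (max s (β + parityShift n)) (β + n + 2)),
        κ * t ^ (κ - 1) * (t - 1) ^ (-κ) * contS κ β (n + 1) (t - 1)

variable {κ : ℝ}

/-- `S_0 = 0` (unused index). [folklore] -/
@[simp] theorem contS_zero (κ β s : ℝ) : contS κ β 0 s = 0 := rfl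

/-- `S_1(s) = (β + 1)^κ − min(s, β + 1)^κ` (Iwaniec's `S⁺_0`, (7.1) first line). [folklore] -/
theorem contS_one (κ β s : ℝ) : contS κ β 1 s = (β + 1) ^ κ - (min s (β + 1)) ^ κ := rfl

/-- The recurrence defining `S_{n+2}` ((7.1), second and third lines). [folklore] -/
theorem contS_succ_succ (κ β : ℝ) (n : ℕ) (s : ℝ) :
    contS κ β (n + 2) s =
      ∫ t in (max s (β + parityShift n))..(max (max s (β + parityShift n)) (β + n + 2)),
        κ * t ^ (κ - 1) * (t - 1) ^ (-κ) * contS κ β (n + 1) (t - 1) := rfl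

/-- **Support**: `S_n(s) = 0` for `s ≥ β + n`, `n ≥ 1` (Iwaniec, p. 193: `T^±_R` has compact support
`[β − (1±1)/2, β + (1±1)/2 + 2R]`; Greaves, remark after (4.1.3.2)).
[cite: IwaniecActaArith1980, §7 (7.1)] -/
theorem contS_eq_zero_of_le {β : ℝ} {n : ℕ} (hn : 1 ≤ n) {s : ℝ} (hs : β + n ≤ s) :
    contS κ β n s = 0 := by
  obtain ⟨m, rfl⟩ : ∃ m, n = m + 1 := ⟨n - 1, by omega⟩
  cases m with
  | zero =>
    rw [contS_one, min_eq_right (by push_cast at hs; linarith), sub_self]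
  | succ m =>
    rw [show m + 1 + 1 = m + 2 by ring, contS_succ_succ]
    have h1 := (parityShift_mem m).2
    have ha : max s (β + parityShift m) = s := max_eq_left (by push_cast at hs; linarith)
    rw [ha, max_eq_left (by push_cast at hs ⊢; linarith), intervalIntegral.integral_same]

/-- **Nonnegativity**: `S_n(s) ≥ 0` for `s ≥ 0` (by induction: the integrands are nonnegative on
`t ≥ β ≥ 1`). [folklore] -/
theorem contS_nonneg (hκ : 0 ≤ κ) {β : ℝ} (hβ : 1 ≤ β) :
    ∀ (n : ℕ) {s : ℝ}, 0 ≤ s → 0 ≤ contS κ β n s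
  | 0, s, _ => le_rfl
  | 1, s, hs => by
    rw [contS_one, sub_nonneg]
    exact Real.rpow_le_rpow (le_min hs (by linarith)) (min_le_right _ _) hκ
  | n + 2, s, hs => by
    rw [contS_succ_succ]
    refine intervalIntegral.integral_nonneg (le_max_left _ _) fun t ht => ?_
    have h0 := (parityShift_mem n).1
    have ht1 : 1 ≤ t := le_trans (by linarith) ((le_max_right _ _).trans ht.1)
    have := contS_nonneg hκ hβ (n + 1) (s := t - 1) (by linarith)
    have h2 : 0 ≤ t ^ (κ - 1) := Real.rpow_nonneg (by linarith) _
    have h3 : 0 ≤ (t - 1) ^ (-κ) := Real.rpow_nonneg (by linarith) _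
    positivity

/-- `BetaSieve.contT par κ β N s = ∑_{n ≤ N, n ≡ par (2)} S_n(s)`: Iwaniec's partial sums
`T⁺_R(s) = ∑_{r ≤ R} S⁺_r(s)` (`par = 1`, `N = 2R + 1`) and `T⁻_R(s) = ∑_{1 ≤ r ≤ R} S⁻_r(s)`
(`par = 0`, `N = 2R`) of (7.1)–(7.2), whose limits `T^±(s)` give `F(s) = 1 + s^{−κ} T⁺(s)`,
`f(s) = 1 − s^{−κ} T⁻(s)` (p. 202). [cite: IwaniecActaArith1980, §7 (7.1)–(7.2)] -/
def contT (par : ℕ) (κ β : ℝ) (N : ℕ) (s : ℝ) : ℝ :=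
  ∑ n ∈ Finset.range (N + 1) with n % 2 = par % 2, contS κ β n s

/-- Unfolding lemma for `contT`. [folklore] -/
theorem contT_def (par : ℕ) (κ β : ℝ) (N : ℕ) (s : ℝ) :
    contT par κ β N s = ∑ n ∈ Finset.range (N + 1) with n % 2 = par % 2, contS κ β n s := rfl

/-- `T^±` with no terms: `contT par κ β 0 s = 0` (only `S_0 = 0` could contribute). [folklore] -/
theorem contT_zero_right (par : ℕ) (κ β s : ℝ) : contT par κ β 0 s = 0 := by
  rw [contT]
  refine Finset.sum_eq_zero fun n hn => ?_
  rw [Finset.mem_filter, Finset.range_one, Finset.mem_singleton] at hn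
  rw [hn.1, contS_zero]

/-- `T^±_R(s) ≥ 0` for `s ≥ 0`. [folklore] -/
theorem contT_nonneg (hκ : 0 ≤ κ) {β : ℝ} (hβ : 1 ≤ β) (par N : ℕ) {s : ℝ} (hs : 0 ≤ s) :
    0 ≤ contT par κ β N s :=
  Finset.sum_nonneg fun n _ => contS_nonneg hκ hβ n hs

/-- For odd `n ≥ 3` the model `S_n` is constant on `s ≤ β + 1` ((7.1), fourth line:
`S⁺_R(s) = S⁺_R(β + 1)` for `β − 1 < s ≤ β + 1`). [cite: IwaniecActaArith1980, §7 (7.1)] -/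
theorem contS_odd_eq_of_le {β : ℝ} {n : ℕ} (hn : n % 2 = 1) (h3 : 3 ≤ n) {s : ℝ} (hs : s ≤ β + 1) :
    contS κ β n s = contS κ β n (β + 1) := by
  obtain ⟨m, rfl⟩ : ∃ m, n = m + 2 := ⟨n - 2, by omega⟩
  rw [contS_succ_succ, contS_succ_succ, parityShift_of_odd (by omega : m % 2 = 1), max_eq_right hs,
    max_self]

/-- **(7.3), third line**: `T⁺_R(s) + s^κ = (β + 1)^κ + T⁺_R(β + 1)` for `s ≤ β + 1` (here for the
partial sums with at least the term `S_1 = S⁺_0`, i.e. `N ≥ 1`).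
[cite: IwaniecActaArith1980, §7 (7.3)] -/
theorem contT_one_eq_of_le {β : ℝ} {N : ℕ} (hN : 1 ≤ N) {s : ℝ} (hs : s ≤ β + 1) :
    contT 1 κ β N s = (β + 1) ^ κ - s ^ κ + contT 1 κ β N (β + 1) := by
  unfold contT
  have h1 : 1 ∈ (Finset.range (N + 1)).filter (fun n => n % 2 = 1 % 2) := by
    rw [Finset.mem_filter, Finset.mem_range]; omega
  rw [← Finset.add_sum_erase _ _ h1, ← Finset.add_sum_erase _ _ h1, contS_one, contS_one,
    min_eq_left hs, min_self, sub_self, zero_add]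
  congr 1
  refine Finset.sum_congr rfl fun n hn => ?_
  rw [Finset.mem_erase, Finset.mem_filter] at hn
  exact contS_odd_eq_of_le (by omega) (by omega) hs

/-- `BetaSieve.discT par g β D P N = ∑_{n ≤ N} T_n(D, P)`: Iwaniec's partial sums `T^±_{R,z}(s)` of
§4 (for `P = P(z)`, `D = y`; the terms of the wrong parity vanish, `bdrySum_eq_zero_of_mod_two_ne`).
[cite: IwaniecActaArith1980, §4 (before (4.3))] -/
def discT (par : ℕ) (g : ArithmeticFunction ℝ) (β D : ℝ) (P N : ℕ) : ℝ :=
  ∑ n ∈ Finset.range (N + 1), bdrySum par g β D P n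

/-- Unfolding lemma for `discT`. [folklore] -/
theorem discT_def (par : ℕ) (g : ArithmeticFunction ℝ) (β D : ℝ) (P N : ℕ) :
    discT par g β D P N = ∑ n ∈ Finset.range (N + 1), bdrySum par g β D P n := rfl

/-- The main term through `discT`: `S^{par}(D, P) = V(P) − (−1)^{par} T^{par}_{ν(P)}(D, P)`.
[cite: IwaniecActaArith1980, (4.1)–(4.2)] -/
theorem mainSum_eq_vprod_sub_discT (hg : g.IsMultiplicative) {P : ℕ} (hP : Squarefree P) (par : ℕ)
    (β D : ℝ) :
    mainSum par g β D P = vprod g P - (-1) ^ par * discT par g β D P P.primeFactors.card :=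
  mainSum_eq_vprod_sub hg hP par β D

/-- `discT` does not change beyond `N = ν(P)` (there are no `t ∣ P` with more prime factors).
[folklore] -/
theorem discT_eq_of_le {P : ℕ} (hP : P ≠ 0) (par : ℕ) (β D : ℝ) {N : ℕ}
    (hN : P.primeFactors.card ≤ N) :
    discT par g β D P N = discT par g β D P P.primeFactors.card := by
  rw [discT, discT, ← Finset.sum_range_add_sum_Ico _ (Nat.succ_le_succ hN)]
  conv_rhs => rw [← add_zero (∑ n ∈ Finset.range _, bdrySum par g β D P n)]
  congr 1
  refine Finset.sum_eq_zero fun n hn => Finset.sum_eq_zero fun t ht => ?_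
  exfalso
  rw [Finset.mem_Ico] at hn
  rw [Finset.mem_filter] at ht
  have := Finset.card_le_card (Nat.primeFactors_mono (Nat.dvd_of_mem_divisors ht.1) hP)
  omega

/-! ### The crude range `log z ≤ s⁵⁰` (Iwaniec (8.4), (9.2)) -/

section Crude

variable {y z : ℝ}

/-- **Support of the boundary terms** (Iwaniec, p. 198: `S^±_{r,z}(s) = 0` for
`s ≥ 2r + β + (1±1)/2`; Greaves Lemma 3.3.5(ii)): if `t ∣ P(z)` lies on the boundary of Rosser's set
of level `y`, then `s = log y / log z < ν(t) + β`; i.e. `χ̄(t) = 0` whenever `ν(t) + β ≤ s` (`β > 0`,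
`z > 1`, `y > 0`).
[cite: IwaniecActaArith1980, §8 (proof of Lemma 20, before (8.4))] -/
theorem bdry_eq_zero_of_card_add_le (hβ : 0 < β) (hz : 1 < z) (hy : 0 < y) {t : ℕ}
    (ht : t ∣ primesProdBelow z) (h : (t.primeFactors.card : ℝ) + β ≤ Real.log y / Real.log z) :
    bdry par β y t = 0 := by
  by_contra hne
  obtain ⟨ht1, -, hle⟩ := of_bdry_ne_zero hne
  have htsq := (squarefree_primesProdBelow z).squarefree_of_dvd ht
  have ht0 := htsq.ne_zero
  have hq := Nat.minFac_prime ht1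
  have hpz : ∀ p ∈ t.primeFactors, (p : ℝ) < z := fun p hp =>
    prime_lt_of_mem_primeFactors_of_dvd ht hp
  have hqz : (t.minFac : ℝ) < z := hpz _ (Nat.mem_primeFactors.mpr ⟨hq, Nat.minFac_dvd t, ht0⟩)
  have hlogz : 0 < Real.log z := Real.log_pos hz
  have hq0 : (0 : ℝ) < t.minFac := by exact_mod_cast hq.pos
  have ht0' : (0 : ℝ) < t := by exact_mod_cast Nat.pos_of_ne_zero ht0
  have h1 : Real.log t ≤ t.primeFactors.card * Real.log z := log_le_card_mul_log htsq hpz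
  have h2 : Real.log t.minFac < Real.log z := Real.log_lt_log hq0 hqz
  have h3 : Real.log y ≤ Real.log t + β * Real.log t.minFac := by
    have := Real.log_le_log hy hle
    rwa [Real.log_mul ht0'.ne' (Real.rpow_pos_of_pos hq0 β).ne', Real.log_rpow hq0] at this
  have h4 : Real.log y < (t.primeFactors.card + β) * Real.log z := by nlinarith
  rw [le_div_iff₀ hlogz] at h
  linarith

/-- Hence `T_n(y, P(z)) = 0` whenever `n + β ≤ s`.
[cite: IwaniecActaArith1980, §8 (before (8.4))] -/
theorem bdrySum_eq_zero_of_card_add_le (hβ : 0 < β) (hz : 1 < z) (hy : 0 < y) {n : ℕ}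
    (h : (n : ℝ) + β ≤ Real.log y / Real.log z) : bdrySum par g β y (primesProdBelow z) n = 0 := by
  refine Finset.sum_eq_zero fun t ht => ?_
  rw [Finset.mem_filter] at ht
  rw [bdry_eq_zero_of_card_add_le hβ hz hy (Nat.dvd_of_mem_divisors ht.1) (ht.2 ▸ h), zero_mul,
    zero_mul]

/-- Rankin's trick for the divisors of a squarefree `P` with exactly `n` prime factors:
`∑_{t ∣ P, ν(t) = n} g(t) ≤ Λ^{−n} ∏_{p ∣ P} (1 + Λ g(p))` (`Λ > 0`, `g ≥ 0` multiplicative).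
[folklore] -/
theorem sum_divisors_card_eq_le (hg : g.IsMultiplicative) {P : ℕ} (hP : Squarefree P)
    (hg0 : ∀ p ∈ P.primeFactors, 0 ≤ g p) {Λ : ℝ} (hΛ : 0 < Λ) (n : ℕ) :
    ∑ t ∈ P.divisors with t.primeFactors.card = n, g t ≤
      (∏ p ∈ P.primeFactors, (1 + Λ * g p)) / Λ ^ n := by
  set C := P.divisors.filter (fun t => t.primeFactors.card = n) with hC
  have hC' : ∀ t ∈ C, Squarefree t ∧ t.primeFactors ⊆ P.primeFactors ∧ t.primeFactors.card = n := by
    intro t ht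
    rw [hC, Finset.mem_filter] at ht
    have hd := Nat.dvd_of_mem_divisors ht.1
    exact ⟨hP.squarefree_of_dvd hd, Nat.primeFactors_mono hd hP.ne_zero, ht.2⟩
  have hinj : Set.InjOn (fun t : ℕ => t.primeFactors) C := by
    intro t₁ h₁ t₂ h₂ heq
    have e₁ := Nat.prod_primeFactors_of_squarefree (hC' t₁ h₁).1
    have e₂ := Nat.prod_primeFactors_of_squarefree (hC' t₂ h₂).1
    rw [← e₁, ← e₂]
    exact congrArg (fun T : Finset ℕ => ∏ p ∈ T, p) heq
  have h1 : ∑ t ∈ C, g t = ∑ T ∈ C.image (fun t : ℕ => t.primeFactors), ∏ p ∈ T, g p := by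
    rw [Finset.sum_image hinj]
    exact Finset.sum_congr rfl fun t ht => map_eq_prod_primeFactors hg (hC' t ht).1
  have h2 : C.image (fun t : ℕ => t.primeFactors) ⊆ P.primeFactors.powersetCard n := by
    intro T hT
    obtain ⟨t, ht, hTt⟩ := Finset.mem_image.mp hT
    rw [← hTt]
    exact Finset.mem_powersetCard.mpr ⟨(hC' t ht).2.1, (hC' t ht).2.2⟩
  rw [h1]
  calc ∑ T ∈ C.image (fun t : ℕ => t.primeFactors), ∏ p ∈ T, g p
      ≤ ∑ T ∈ P.primeFactors.powersetCard n, ∏ p ∈ T, g p :=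
        Finset.sum_le_sum_of_subset_of_nonneg h2 fun T hT _ =>
          Finset.prod_nonneg fun p hp => hg0 p ((Finset.mem_powersetCard.mp hT).1 hp)
    _ ≤ _ := sum_powersetCard_prod_le P.primeFactors (fun p => g p) hg0 hΛ n

/-- `1 + Λ u ≤ (1 − u)^{−Λ}` for `u < 1`, `Λ ≥ 0` (`1 + x ≤ e^x` and `−log(1 − u) ≥ u`).
[folklore] -/
theorem one_add_mul_le_rpow_neg {u Λ : ℝ} (hu1 : u < 1) (hΛ : 0 ≤ Λ) :
    1 + Λ * u ≤ (1 - u) ^ (-Λ) := by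
  have h1u : 0 < 1 - u := by linarith
  rw [Real.rpow_def_of_pos h1u]
  have hlog : Real.log (1 - u) ≤ -u := by linarith [Real.log_le_sub_one_of_pos h1u]
  calc 1 + Λ * u ≤ Real.exp (Λ * u) := by linarith [Real.add_one_le_exp (Λ * u)]
    _ ≤ Real.exp (Real.log (1 - u) * -Λ) := Real.exp_le_exp.mpr (by nlinarith)

/-- `∏_{p ∣ P} (1 + Λ g(p)) ≤ V(P)^{−Λ}` when `0 ≤ g(p) < 1` on the prime factors of `P`, `Λ ≥ 0`.
[folklore] -/
theorem prod_one_add_mul_le {P : ℕ} (h01 : ∀ p ∈ P.primeFactors, 0 ≤ g p ∧ g p < 1) {Λ : ℝ}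
    (hΛ : 0 ≤ Λ) :
    ∏ p ∈ P.primeFactors, (1 + Λ * g p) ≤ (vprod g P) ^ (-Λ) := by
  rw [vprod, ← Real.finsetProd_rpow _ _ (fun p hp => (sub_pos.mpr (h01 p hp).2).le)]
  refine Finset.prod_le_prod (fun p hp => ?_) fun p hp => ?_
  · have := (h01 p hp).1; positivity
  · exact one_add_mul_le_rpow_neg (h01 p hp).2 hΛ

/-- Termwise bound `T_n(D, P) ≤ ∑_{t ∣ P, ν(t) = n} g(t)` (`χ̄ ≤ 1`, `V(P; q) ≤ 1`), for
`0 ≤ g(p) ≤ 1` on the prime factors of the squarefree `P`. [folklore] -/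
theorem bdrySum_le_sum (hg : g.IsMultiplicative) {P : ℕ} (hP : Squarefree P)
    (h01 : ∀ p ∈ P.primeFactors, 0 ≤ g p ∧ g p ≤ 1) (par : ℕ) (β D : ℝ) (n : ℕ) :
    bdrySum par g β D P n ≤ ∑ t ∈ P.divisors with t.primeFactors.card = n, g t := by
  refine Finset.sum_le_sum fun t ht => ?_
  have hd := Nat.dvd_of_mem_divisors (Finset.mem_filter.mp ht).1
  have hgt : 0 ≤ g t := by
    rw [map_eq_prod_primeFactors hg (hP.squarefree_of_dvd hd)]
    exact Finset.prod_nonneg fun p hp => (h01 p (Nat.primeFactors_mono hd hP.ne_zero hp)).1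
  have hv1 : vlt g P t.minFac ≤ 1 := by
    have := vlt_anti (g := g) h01 (Nat.zero_le t.minFac)
    rwa [show vlt g P 0 = 1 from Finset.prod_eq_one fun p hp => by simp at hp] at this
  calc bdry par β D t * g t * vlt g P t.minFac ≤ g t * 1 :=
        mul_le_mul (mul_le_of_le_one_left hgt (bdry_le_one t)) hv1 (vlt_nonneg h01 _) hgt
    _ = g t := mul_one _

/-- `0 ≤ T_n(D, P)`. [folklore] -/
theorem bdrySum_nonneg (hg : g.IsMultiplicative) {P : ℕ} (hP : Squarefree P)
    (h01 : ∀ p ∈ P.primeFactors, 0 ≤ g p ∧ g p ≤ 1) (par : ℕ) (β D : ℝ) (n : ℕ) :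
    0 ≤ bdrySum par g β D P n := by
  refine Finset.sum_nonneg fun t ht => ?_
  have hd := Nat.dvd_of_mem_divisors (Finset.mem_filter.mp ht).1
  have hgt : 0 ≤ g t := by
    rw [map_eq_prod_primeFactors hg (hP.squarefree_of_dvd hd)]
    exact Finset.prod_nonneg fun p hp => (h01 p (Nat.primeFactors_mono hd hP.ne_zero hp)).1
  exact mul_nonneg (mul_nonneg (bdry_nonneg t) hgt) (vlt_nonneg h01 _)

/-- `0 ≤ T^{par}_N(D, P)`. [folklore] -/
theorem discT_nonneg (hg : g.IsMultiplicative) {P : ℕ} (hP : Squarefree P)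
    (h01 : ∀ p ∈ P.primeFactors, 0 ≤ g p ∧ g p ≤ 1) (par : ℕ) (β D : ℝ) (N : ℕ) :
    0 ≤ discT par g β D P N :=
  Finset.sum_nonneg fun n _ => bdrySum_nonneg hg hP h01 par β D n

/-- `log 3 ≥ 1` (`e < 3`). [folklore] -/
theorem one_le_log_three : (1 : ℝ) ≤ Real.log 3 := by
  rw [Real.le_log_iff_exp_le (by norm_num)]
  exact (Real.exp_one_lt_d9.trans (by norm_num)).le

/-- `s^M e^{−s} ≤ M!` for `s ≥ 0`. [folklore] -/
theorem pow_mul_exp_neg_le_factorial {s : ℝ} (hs : 0 ≤ s) (M : ℕ) :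
    s ^ M * Real.exp (-s) ≤ M.factorial := by
  have h := Real.pow_div_factorial_le_exp s hs M
  rw [div_le_iff₀ (by positivity)] at h
  rw [Real.exp_neg, ← div_eq_mul_inv, div_le_iff₀ (Real.exp_pos s), mul_comm]
  exact h

/-- **The crude range** (Iwaniec (8.4) and (9.2), qualitative form): for `0 < κ`, `β ≥ 1`, `L ≥ 0`
there is `C = C(κ, β, L)` such that for every multiplicative `g` with `Ω(κ, L)` and all `2 ≤ z ≤ y`
with `log z ≤ s⁵⁰`, `s = log y / log z`: `∑_{n ≤ N} T_n(y, P(z)) ≤ C V(z) (log y)^{−1/3}` for both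
parities and all `N`. (Proof: the terms with `n + β ≤ s` vanish; Rankin's trick with `Λ = 3` bounds
the rest by `(3/2) V(z)^{−3} 3^{−(s−β)}`, and
`V(z)^{−1} ≤ (1 + L/log 2)(log z/log 2)^κ ≤ C' s^{50κ}`, while `(log y)^{−1/3} ≥ s^{−17}`; Iwaniec's
sharper (8.4) keeps track of the `s`-decay.)
[cite: IwaniecActaArith1980, §8 (8.4) and §9 (9.2)] -/
theorem discT_le_of_log_le_pow {κ β L : ℝ} (hκ : 0 < κ) (hβ : 1 ≤ β) (hL : 0 ≤ L) :
    ∃ C : ℝ, 0 ≤ C ∧ ∀ g : ArithmeticFunction ℝ, g.IsMultiplicative → HasIwaniecDimension g κ L →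
      ∀ y z : ℝ, 2 ≤ z → z ≤ y → Real.log z ≤ (Real.log y / Real.log z) ^ 50 → ∀ (par N : ℕ),
        discT par g β y (primesProdBelow z) N ≤
          C * vprod g (primesProdBelow z) * Real.log y ^ (-(1 / 3 : ℝ)) := by
  -- constants
  set m' : ℕ := ⌈50 * κ⌉₊ with hm'
  set K₁ : ℝ := (1 + L / Real.log 2) / Real.log 2 ^ κ with hK₁
  set M : ℕ := 4 * m' + 17 with hM
  have hlog2 : 0 < Real.log 2 := Real.log_pos one_lt_two
  have hK₁0 : 0 < K₁ := div_pos (by positivity) (Real.rpow_pos_of_pos hlog2 κ)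
  refine ⟨3 / 2 * (3 : ℝ) ^ β * K₁ ^ 4 * M.factorial, by positivity, ?_⟩
  intro g hg hdim y z hz hzy hcase par N
  set s := Real.log y / Real.log z with hs
  set V := vprod g (primesProdBelow z) with hV
  have hz1 : 1 < z := by linarith
  have hlogz : 0 < Real.log z := Real.log_pos hz1
  have hlogy : 0 < Real.log y := Real.log_pos (by linarith)
  have hs1 : 1 ≤ s := by
    rw [hs, le_div_iff₀ hlogz, one_mul]; exact Real.log_le_log (by linarith) hzy
  have hs0 : 0 < s := by linarith
  have hy : 0 < y := by linarith
  have hβ0 : 0 < β := by linarith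
  have hVpos : 0 < V := hdim.vprod_pos z
  have h01 : ∀ p ∈ (primesProdBelow z).primeFactors, 0 ≤ g p ∧ g p < 1 := fun p hp =>
    hdim.1 p (Nat.prime_of_mem_primeFactors hp)
  have h01' : ∀ p ∈ (primesProdBelow z).primeFactors, 0 ≤ g p ∧ g p ≤ 1 := fun p hp =>
    ⟨(h01 p hp).1, (h01 p hp).2.le⟩
  have hPsq := squarefree_primesProdBelow z
  -- (a) `V⁻¹ ≤ K₁ s^{m'}`
  have hVinv : V⁻¹ ≤ K₁ * s ^ m' := by
    have h1 := hdim.inv_vprod_le hz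
    have h2 : (Real.log z / Real.log 2) ^ κ ≤ (s ^ (50 : ℕ) / Real.log 2) ^ κ :=
      Real.rpow_le_rpow (by positivity) (div_le_div_of_nonneg_right hcase hlog2.le) hκ.le
    have h3 : (s ^ (50 : ℕ) / Real.log 2) ^ κ = (s ^ (50 : ℕ)) ^ κ / Real.log 2 ^ κ :=
      Real.div_rpow (by positivity) hlog2.le κ
    have h4 : (s ^ (50 : ℕ)) ^ κ ≤ s ^ m' := by
      rw [← Real.rpow_natCast s 50, ← Real.rpow_mul hs0.le, ← Real.rpow_natCast s m']
      exact Real.rpow_le_rpow_of_exponent_le hs1 (by push_cast; exact Nat.le_ceil _)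
    calc V⁻¹ ≤ (Real.log z / Real.log 2) ^ κ * (1 + L / Real.log 2) := h1
      _ ≤ (s ^ m' / Real.log 2 ^ κ) * (1 + L / Real.log 2) := by
          gcongr
          exact h2.trans
            (h3.le.trans (div_le_div_of_nonneg_right h4 (Real.rpow_pos_of_pos hlog2 κ).le))
      _ = K₁ * s ^ m' := by rw [hK₁]; ring
  -- (b) Rankin with `Λ = 3`: `discT ≤ V^{-3} (1/3)^{n₀} / (1 - 1/3)`, `n₀ = ⌊s - β⌋₊ + 1`
  set n₀ : ℕ := ⌊s - β⌋₊ + 1 with hn₀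
  have hterm : ∀ n ∈ Finset.range (N + 1), bdrySum par g β y (primesProdBelow z) n ≤
      if n₀ ≤ n then V ^ (-(3 : ℝ)) * (1 / 3 : ℝ) ^ n else 0 := by
    intro n _
    split_ifs with hn
    · calc bdrySum par g β y (primesProdBelow z) n
          ≤ ∑ t ∈ (primesProdBelow z).divisors with t.primeFactors.card = n, g t :=
            bdrySum_le_sum hg hPsq h01' par β y n
        _ ≤ (∏ p ∈ (primesProdBelow z).primeFactors, (1 + 3 * g p)) / 3 ^ n :=
            sum_divisors_card_eq_le hg hPsq (fun p hp => (h01 p hp).1) (by norm_num) n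
        _ ≤ V ^ (-(3 : ℝ)) / 3 ^ n :=
            div_le_div_of_nonneg_right (prod_one_add_mul_le h01 (by norm_num)) (by positivity)
        _ = V ^ (-(3 : ℝ)) * (1 / 3 : ℝ) ^ n := by rw [one_div, inv_pow, div_eq_mul_inv]
    · push Not at hn
      rcases Nat.eq_zero_or_pos n with hn0 | hnpos
      · subst hn0; exact (bdrySum_zero par g β y (primesProdBelow_ne_zero z)).le
      · refine (bdrySum_eq_zero_of_card_add_le hβ0 hz1 hy ?_).le
        have hnle : n ≤ ⌊s - β⌋₊ := Nat.le_of_lt_succ hn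
        have hpos : 0 < ⌊s - β⌋₊ := lt_of_lt_of_le hnpos hnle
        have hsb : 0 ≤ s - β := by
          have := Nat.floor_pos.mp hpos
          linarith
        have : (n : ℝ) ≤ ⌊s - β⌋₊ := by exact_mod_cast hnle
        linarith [Nat.floor_le hsb]
  have hsum : discT par g β y (primesProdBelow z) N ≤
      V ^ (-(3 : ℝ)) * ((1 / 3 : ℝ) ^ n₀ / (1 - 1 / 3)) := by
    calc discT par g β y (primesProdBelow z) N
        ≤ ∑ n ∈ Finset.range (N + 1), (if n₀ ≤ n then V ^ (-(3 : ℝ)) * (1 / 3 : ℝ) ^ n else 0) :=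
          Finset.sum_le_sum hterm
      _ = V ^ (-(3 : ℝ)) * ∑ n ∈ Finset.Ico n₀ (N + 1), (1 / 3 : ℝ) ^ n := by
          rw [← Finset.sum_filter, Finset.mul_sum]
          refine Finset.sum_congr ?_ fun _ _ => rfl
          ext n
          simp only [Finset.mem_filter, Finset.mem_range, Finset.mem_Ico, and_comm]
      _ ≤ V ^ (-(3 : ℝ)) * ((1 / 3 : ℝ) ^ n₀ / (1 - 1 / 3)) :=
          mul_le_mul_of_nonneg_left (geom_sum_Ico_le_of_lt_one (by norm_num) (by norm_num))
            (Real.rpow_nonneg hVpos.le _)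
  -- (c) `(1/3)^{n₀} ≤ 3^β e^{-s}`
  have hgeo : (1 / 3 : ℝ) ^ n₀ ≤ (3 : ℝ) ^ β * Real.exp (-s) := by
    have hn₀s : s - β < n₀ := by rw [hn₀]; push_cast; exact Nat.lt_floor_add_one (s - β)
    have e1 : (1 / 3 : ℝ) ^ n₀ = (3 : ℝ) ^ (-(n₀ : ℝ)) := by
      rw [Real.rpow_neg (by norm_num), Real.rpow_natCast, one_div, inv_pow]
    rw [e1]
    calc (3 : ℝ) ^ (-(n₀ : ℝ)) ≤ (3 : ℝ) ^ (β - s) :=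
          Real.rpow_le_rpow_of_exponent_le (by norm_num) (by linarith)
      _ = (3 : ℝ) ^ β * (3 : ℝ) ^ (-s) := by rw [sub_eq_add_neg, Real.rpow_add (by norm_num)]
      _ ≤ (3 : ℝ) ^ β * Real.exp (-s) := by
          gcongr
          rw [Real.rpow_def_of_pos (by norm_num)]
          exact Real.exp_le_exp.mpr (by nlinarith [one_le_log_three])
  -- (d) `(s^17)⁻¹ ≤ (log y)^{-1/3}`
  have hly : (s ^ 17)⁻¹ ≤ Real.log y ^ (-(1 / 3 : ℝ)) := by
    have hlogy_eq : Real.log y = s * Real.log z := by rw [hs, div_mul_cancel₀ _ hlogz.ne']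
    have hle : Real.log y ≤ s ^ (51 : ℕ) := by
      rw [hlogy_eq, pow_succ']
      exact mul_le_mul_of_nonneg_left hcase hs0.le
    calc (s ^ 17)⁻¹ = (s ^ (51 : ℕ)) ^ (-(1 / 3 : ℝ)) := by
          rw [← Real.rpow_natCast s 51, ← Real.rpow_mul hs0.le, ← Real.rpow_natCast s 17,
            ← Real.rpow_neg hs0.le]
          norm_num
      _ ≤ Real.log y ^ (-(1 / 3 : ℝ)) := Real.rpow_le_rpow_of_nonpos hlogy hle (by norm_num)
  -- (e) assembly
  have hfac := pow_mul_exp_neg_le_factorial hs0.le M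
  have hVle : (K₁ * s ^ m')⁻¹ ≤ V := by rw [inv_le_comm₀ (by positivity) hVpos]; exact hVinv
  have hV3 : V ^ (-(3 : ℝ)) ≤ (K₁ * s ^ m') ^ 3 := by
    rw [Real.rpow_neg hVpos.le, show (3 : ℝ) = ((3 : ℕ) : ℝ) by norm_num, Real.rpow_natCast,
      ← inv_pow]
    exact pow_le_pow_left₀ (inv_nonneg.mpr hVpos.le) hVinv 3
  calc discT par g β y (primesProdBelow z) N
      ≤ V ^ (-(3 : ℝ)) * ((1 / 3 : ℝ) ^ n₀ / (1 - 1 / 3)) := hsum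
    _ ≤ (K₁ * s ^ m') ^ 3 * (((3 : ℝ) ^ β * Real.exp (-s)) / (1 - 1 / 3)) := by
        gcongr
    _ = (3 / 2 * (3 : ℝ) ^ β * K₁ ^ 4 * (s ^ M * Real.exp (-s))) *
          ((K₁ * s ^ m')⁻¹ * (s ^ 17)⁻¹) := by
        rw [hM]
        field_simp
        ring
    _ ≤ (3 / 2 * (3 : ℝ) ^ β * K₁ ^ 4 * M.factorial) *
          (V * Real.log y ^ (-(1 / 3 : ℝ))) := by
        gcongr
    _ = _ := by ring

end Crude

end BetaSieve

/-! ### Iwaniec's Lemmas 18 and 20 (named facts) -/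

/-- **Iwaniec's Lemma 18, as used in the proof of Theorem 1** (*Rosser's sieve*, Acta Arith. 36
(1980), Lemma 18 with (7.7) and p. 202). Lemma 18: the series (7.1)–(7.2)
`T^±(s) = lim_R T^±_R(s)` converge, `0 < T^±(s) ≪ s^{κ+1} Q^±(s)`, `T^±(s) ± s^κ` is constant for
`s ≤ β + (1±1)/2` and `T^±(s) = κ ∫_s^∞ (1 − 1/t)^{−κ} T^∓(t − 1) dt/t` for `s ≥ β + (1±1)/2` (7.7);
on p. 202 Iwaniec puts `F(s) = 1 + s^{−κ} T⁺(s)` for `s ≥ β + 1`, `f(s) = 1 − s^{−κ} T⁻(s)` for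
`s ≥ β`, `s^κ F(s) = (β + 1)^κ F(β + 1)` for `1 ≤ s ≤ β + 1`, and these `(F, f)` with `β = β_κ`
(`β_κ − 1` the largest zero of `g`, `β_{1/2} = 1`, §7) and `A = 2(β − 1)^{κ−1}/h(β − 1)`, `B = 0`
(p. 196) form the normalised solution of (1.8)–(1.10), i.e. Iwaniec's `β`-sieve data; by the
necessity of `g(β − 1) = 0` for every normalised solution [Greaves2001, (4.2.4.10);
`IsBetaSieveSolution.adjoint_apply_eq_zero` in `SieveAdjoint.lean`] and the uniqueness of greatest
data (`IsGreatestBetaSieveData.unique`) they are THE greatest `β`-sieve data of dimension `κ`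
(`IsGreatestBetaSieveData`, `SieveFunctions.lean`, correction section). Since the terms `S^±_r ≥ 0`,
the partial sums satisfy `T^±_R ≤ T^±`. Vendored form, on the printed ranges: for `κ ≥ 1/2` and
greatest `β`-sieve data `(F, f, β, A)` of dimension `κ`, for all `N` and `s`,
`T⁺_N(s) ≤ s^κ (F(s) − 1)` whenever `s ≥ β + 1`, and `T⁻_N(s) ≤ s^κ (1 − f(s))` whenever `s ≥ β`,
where `T^{par}_N(s) = BetaSieve.contT par κ β N s = ∑_{n ≤ N, n ≡ par} S_n(s)` are the partial sums
of Iwaniec's series built from `BetaSieve.contS` ((7.1)). The extension of the `+` inequality to all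
`0 < s ≤ β + 1` is PROVED below from (7.3) and (1.8) (`Iwaniec1980_lemma18.upper_of_pos`). This is
the "convergence problem" half of the analytic step (Greaves, *Sieves in Number Theory*, Prop. 4.2.1 and
§4.3, for the equivalent series `F = 1 + ∑ f_{2j+1}`, `f = 1 − ∑ f_{2j}`).
[cite: IwaniecActaArith1980, Lemma 18 with (7.7) and p. 202] -/
def Iwaniec1980_lemma18 : Prop :=
  ∀ {κ : ℝ} (_hκ : 1 / 2 ≤ κ) (B : (ℝ → ℝ) × (ℝ → ℝ) × ℝ × ℝ) (_hB : IsGreatestBetaSieveData κ B)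
    (N : ℕ) (s : ℝ),
    (B.2.2.1 + 1 ≤ s → BetaSieve.contT 1 κ B.2.2.1 N s ≤ s ^ κ * (B.1 s - 1)) ∧
      (B.2.2.1 ≤ s → BetaSieve.contT 0 κ B.2.2.1 N s ≤ s ^ κ * (1 - B.2.1 s))

/-- **Iwaniec's Lemma 20, in the form (9.1)** (*Rosser's sieve*, Acta Arith. 36 (1980), §8 Lemma 20
and §9 (9.1)). Lemma 20, verbatim: "For `y ≥ 2`, `z ≥ 2`, and `s > β − (1±1)/2` we have
`T^±_{R,z}(s) < V(z) s^{−κ} {T^±_R(s) + G^±_z(s) (log y)^{−1/3}}` (8.1), where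
`G^±_z(s) = C e^{√K} (1 + s^{50}/log y)^s q^±(s)` and `C` is some constant depending at most on
`κ`" (`q^±` as in Lemma 17, `s = log y/log z`). Here `T^±_{R,z}(s)` are the partial sums of the
sieve sums `S^±_{r,z}(s)` of (4.1)–(4.2) (our `BetaSieve.discT par g β y (P(z)) N`, `N = 2R + 1`
resp. `2R`), `T^±_R(s)` the partial sums (7.1)–(7.2) of the continuous models
(`BetaSieve.contT par κ β N s`), `V(z) = ∏_{p<z} (1 − g(p))`, `g(p) = ω(p)/p` subject to
(1.2)–(1.3), and `β = β_κ` (§7; the `β` of the greatest `β`-sieve data, see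
`Iwaniec1980_lemma18`); `Ω(κ, L)` (`HasIwaniecDimension`) implies (1.3) with `K = L + 2`, as in
`Iwaniec1980_mainTerm_lower`. For `s^{50} ≤ log z` one has `(1 + s^{50}/log y)^s ≤ e` and hence
(9.1): `T^±_{R,z}(s) < V(z) s^{−κ} {T^±_R(s) + O(e^{1+√K} q^±(s)) (log y)^{−1/3}}`; as `q^±` is
constant on `(0, β + (1±1)/2]` and non-increasing beyond ((7.4), positive integrand), the error is
at most `C(κ, L) (log y)^{−1/3}`. Vendored form, with the printed STRICT ranges: for `κ ≥ 1/2`,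
greatest `β`-sieve data `(F, f, β, A)` of dimension `κ` and every `L` there is `C` with: for every
multiplicative `g` with `Ω(κ, L)`, all `2 ≤ z ≤ y` with `s^{50} ≤ log z` and all `N`,
`T⁺_N(y, P(z)) ≤ V(z) s^{−κ} (T⁺_N(s) + C (log y)^{−1/3})` if `z^{β−1} < y` (`s > β − 1`), and
`T⁻_N(y, P(z)) ≤ V(z) s^{−κ} (T⁻_N(s) + C (log y)^{−1/3})` if `z^β < y` (`s > β`).
(The extra hypothesis `z ≤ y`, `≤` for `<` in (8.1), and the folding of `e^{√K} sup q^±` into `C`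
make this weaker than the printed lemma. The endpoints `s = β − 1`, `s = β` needed by Theorem 1 are
recovered in `Iwaniec1980_mainTerm_lower_of` / `_upper_of` by shrinking `z` without changing
`P(z)`.)
[cite: IwaniecActaArith1980, Lemma 20 and (9.1)] -/
def Iwaniec1980_lemma20 : Prop :=
  ∀ {κ : ℝ} (_hκ : 1 / 2 ≤ κ) (B : (ℝ → ℝ) × (ℝ → ℝ) × ℝ × ℝ) (_hB : IsGreatestBetaSieveData κ B)
    (L : ℝ), ∃ C : ℝ, ∀ g : ArithmeticFunction ℝ, g.IsMultiplicative → HasIwaniecDimension g κ L →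
      ∀ y z : ℝ, 2 ≤ z → z ≤ y → (Real.log y / Real.log z) ^ 50 ≤ Real.log z → ∀ N : ℕ,
        (z ^ (B.2.2.1 - 1) < y →
          BetaSieve.discT 1 g B.2.2.1 y (primesProdBelow z) N ≤
            BetaSieve.vprod g (primesProdBelow z) * (Real.log y / Real.log z) ^ (-κ) *
              (BetaSieve.contT 1 κ B.2.2.1 N (Real.log y / Real.log z) +
                C * Real.log y ^ (-(1 / 3 : ℝ)))) ∧
        (z ^ B.2.2.1 < y →
          BetaSieve.discT 0 g B.2.2.1 y (primesProdBelow z) N ≤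
            BetaSieve.vprod g (primesProdBelow z) * (Real.log y / Real.log z) ^ (-κ) *
              (BetaSieve.contT 0 κ B.2.2.1 N (Real.log y / Real.log z) +
                C * Real.log y ^ (-(1 / 3 : ℝ))))

/-! ### Consequences of Lemma 18 on `(0, β + 1]` and of the `β`-sieve system near `β` -/

/-- **Extension of the `+` half of Lemma 18 to `0 < s ≤ β + 1`** ((7.3), third line, and (1.8)): for
greatest data `(F, f, β, A)`, `T⁺_N(s) ≤ s^κ (F(s) − 1)` for every `s > 0`. For `s ≤ β + 1` and
`N ≥ 1`,
`T⁺_N(s) = (β + 1)^κ − s^κ + T⁺_N(β + 1) ≤ (β + 1)^κ F(β + 1) − s^κ = A − s^κ = s^κ F(s) − s^κ`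
(`contT_one_eq_of_le`, `IsBetaSieveSolution.upper_eq`); for `N = 0` one needs `F(s) ≥ 1`, which
follows from `F(s) = A s^{−κ} ≥ A (β + 1)^{−κ} = F(β + 1) ≥ 1`.
[cite: IwaniecActaArith1980, §7 (7.3) and (1.8)] -/
theorem Iwaniec1980_lemma18.upper_of_pos (h18 : Iwaniec1980_lemma18) {κ : ℝ} (hκ : 1 / 2 ≤ κ)
    {B : (ℝ → ℝ) × (ℝ → ℝ) × ℝ × ℝ} (hB : IsGreatestBetaSieveData κ B) (N : ℕ) {s : ℝ}
    (hs : 0 < s) : BetaSieve.contT 1 κ B.2.2.1 N s ≤ s ^ κ * (B.1 s - 1) := by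
  obtain ⟨F, f, β, A⟩ := B
  have hsol : IsBetaSieveSolution κ F f β A := hB.1
  dsimp only at *
  rcases le_or_gt (β + 1) s with h1 | h1
  · exact (h18 hκ (F, f, β, A) hB N s).1 h1
  have hβ := hsol.one_le
  have hA := hsol.pos
  have hκ0 : 0 < κ := by linarith
  have hβ1 : 0 < β + 1 := by linarith
  have hFβ := (h18 hκ (F, f, β, A) hB N (β + 1)).1 le_rfl
  have hF0 := (h18 hκ (F, f, β, A) hB 0 (β + 1)).1 le_rfl
  dsimp only at hFβ hF0
  rw [BetaSieve.contT_zero_right] at hF0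
  have hFs : F s = A * s ^ (-κ) := hsol.upper_eq s ⟨hs, h1.le⟩
  have hFb : F (β + 1) = A * (β + 1) ^ (-κ) := hsol.upper_eq (β + 1) ⟨hβ1, le_rfl⟩
  have hpowb : 0 < (β + 1) ^ κ := Real.rpow_pos_of_pos hβ1 κ
  have hpows : 0 < s ^ κ := Real.rpow_pos_of_pos hs κ
  have eb : (β + 1) ^ κ * (β + 1) ^ (-κ) = 1 := by
    rw [Real.rpow_neg hβ1.le, mul_inv_cancel₀ hpowb.ne']
  have es : s ^ κ * s ^ (-κ) = 1 := by rw [Real.rpow_neg hs.le, mul_inv_cancel₀ hpows.ne']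
  have hF1 : 1 ≤ F (β + 1) := by nlinarith
  rcases Nat.eq_zero_or_pos N with hN | hN
  · subst hN
    rw [BetaSieve.contT_zero_right]
    -- `F s = A s^{-κ} ≥ A (β+1)^{-κ} = F (β + 1) ≥ 1`
    have hmono : (β + 1) ^ (-κ) ≤ s ^ (-κ) :=
      Real.rpow_le_rpow_of_nonpos hs h1.le (by linarith)
    have : F (β + 1) ≤ F s := by rw [hFs, hFb]; exact mul_le_mul_of_nonneg_left hmono hA.le
    nlinarith
  · rw [BetaSieve.contT_one_eq_of_le hN h1.le]
    have key : (β + 1) ^ κ * (F (β + 1) - 1) = A - (β + 1) ^ κ := by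
      rw [hFb, mul_sub, ← mul_assoc, mul_comm ((β + 1) ^ κ) A, mul_assoc, eb]; ring
    have key2 : s ^ κ * (F s - 1) = A - s ^ κ := by
      rw [hFs, mul_sub, ← mul_assoc, mul_comm (s ^ κ) A, mul_assoc, es]; ring
    rw [key2]
    linarith [hFβ, key]

/-- `F ≥ 1` on `(0, ∞)` for the greatest data, granted Lemma 18 (`T⁺_0 = 0 ≤ s^κ (F(s) − 1)`).
[folklore] -/
theorem Iwaniec1980_lemma18.one_le_upper (h18 : Iwaniec1980_lemma18) {κ : ℝ} (hκ : 1 / 2 ≤ κ)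
    {B : (ℝ → ℝ) × (ℝ → ℝ) × ℝ × ℝ} (hB : IsGreatestBetaSieveData κ B) {s : ℝ} (hs : 0 < s) :
    1 ≤ B.1 s := by
  have h := h18.upper_of_pos hκ hB 0 hs
  rw [BetaSieve.contT_zero_right] at h
  have hpows : 0 < s ^ κ := Real.rpow_pos_of_pos hs κ
  nlinarith

/-- `f ≤ 1` on `[β, ∞)` for the greatest data, granted Lemma 18 (`T⁻_0 = 0 ≤ s^κ (1 − f(s))`).
[folklore] -/
theorem Iwaniec1980_lemma18.lower_le_one (h18 : Iwaniec1980_lemma18) {κ : ℝ} (hκ : 1 / 2 ≤ κ)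
    {B : (ℝ → ℝ) × (ℝ → ℝ) × ℝ × ℝ} (hB : IsGreatestBetaSieveData κ B) {s : ℝ} (hs : B.2.2.1 ≤ s) :
    B.2.1 s ≤ 1 := by
  have h := (h18 hκ B hB 0 s).2 hs
  rw [BetaSieve.contT_zero_right] at h
  have hpows : 0 < s ^ κ := Real.rpow_pos_of_pos (by linarith [hB.1.one_le]) κ
  nlinarith

/-- **`f ≥ 0` just above `β`** (from the `β`-sieve system alone): for a solution of (1.8)–(1.10) with
`κ > 0`, `s ↦ s^κ f(s)` has derivative `κ s^{κ−1} F(s − 1) = κ s^{κ−1} A (s − 1)^{−κ} ≥ 0` on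
`(β, β + 2)` and vanishes at `β`, so `f ≥ 0` on `[β, β + 2]` (Iwaniec, p. 173: `0 < f < 1` for
`s > β`). [cite: IwaniecActaArith1980, (1.8)–(1.9)] -/
theorem IsBetaSieveSolution.lower_nonneg_of_mem_Icc {κ : ℝ} {F f : ℝ → ℝ} {β A : ℝ}
    (h : IsBetaSieveSolution κ F f β A) (hκ : 0 < κ) {s : ℝ} (hs : s ∈ Set.Icc β (β + 2)) :
    0 ≤ f s := by
  have hβ := h.one_le
  have hmono : MonotoneOn (fun t : ℝ => t ^ κ * f t) (Set.Icc β (β + 2)) := by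
    refine monotoneOn_of_deriv_nonneg (convex_Icc β (β + 2)) ?_ ?_ ?_
    · refine ContinuousOn.mul (fun t ht => ?_) (h.continuousOn_lower.mono fun t ht => ?_)
      · exact (Real.continuousAt_rpow_const _ _ (Or.inl (by linarith [ht.1]))).continuousWithinAt
      · exact lt_of_lt_of_le (by linarith) ht.1
    · intro t ht
      rw [interior_Icc] at ht
      exact (h.hasDerivAt_lower t ht.1).differentiableAt.differentiableWithinAt
    · intro t ht
      rw [interior_Icc] at ht
      rw [(h.hasDerivAt_lower t ht.1).deriv]
      have ht1 : 0 < t - 1 := by linarith [ht.1]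
      have hF : F (t - 1) = A * (t - 1) ^ (-κ) := h.upper_eq (t - 1) ⟨ht1, by linarith [ht.2]⟩
      rw [hF]
      have h1 : 0 ≤ t ^ (κ - 1) := Real.rpow_nonneg (by linarith [ht.1]) _
      have h2 : 0 < (t - 1) ^ (-κ) := Real.rpow_pos_of_pos ht1 _
      have hA := h.pos
      positivity
  have hfβ : f β = 0 := h.lower_eq β ⟨by linarith, le_rfl⟩
  have hle := hmono ⟨le_rfl, by linarith⟩ hs hs.1
  dsimp only at hle
  rw [hfβ, mul_zero] at hle
  have hsκ : 0 < s ^ κ := Real.rpow_pos_of_pos (by linarith [hs.1]) κ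
  exact (mul_nonneg_iff_of_pos_left hsκ).mp hle

/-! ### Shrinking `z` without changing `P(z)` -/

/-- For `z > 2` and `t < z` there is `z'` with `max(t, 2) ≤ z' < z` and `P(z') = P(z)` (any `z'`
between the largest prime below `z` and `z`). Used to recover the endpoint cases `s = β`, `s = β − 1`
of the main-term estimates from the strict ranges of Lemma 20. [folklore] -/
theorem exists_lt_primesProdBelow_eq {z t : ℝ} (hz : 2 < z) (ht : t < z) :
    ∃ z' : ℝ, 2 ≤ z' ∧ t ≤ z' ∧ z' < z ∧ primesProdBelow z' = primesProdBelow z := by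
  classical
  set S := Nat.primesBelow ⌈z⌉₊ with hS
  have h2 : 2 ∈ S := Nat.mem_primesBelow.mpr ⟨Nat.lt_ceil.mpr (by exact_mod_cast hz), Nat.prime_two⟩
  have hne : S.Nonempty := ⟨2, h2⟩
  set q := S.max' hne with hq
  have hqS : q ∈ S := Finset.max'_mem S hne
  have hqz : (q : ℝ) < z := Nat.lt_ceil.mp (Nat.lt_of_mem_primesBelow hqS)
  have hlt : max (max t 2) ((q + z) / 2) < z := max_lt (max_lt ht hz) (by linarith)
  refine ⟨max (max t 2) ((q + z) / 2), le_trans (le_max_right _ _) (le_max_left _ _),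
    le_trans (le_max_left _ _) (le_max_left _ _), hlt, ?_⟩
  unfold primesProdBelow
  refine Finset.prod_congr ?_ fun _ _ => rfl
  ext p
  simp only [Nat.mem_primesBelow, Nat.lt_ceil]
  constructor
  · rintro ⟨hp, hpp⟩
    exact ⟨lt_trans hp hlt, hpp⟩
  · rintro ⟨hp, hpp⟩
    have hpS : p ∈ S := Nat.mem_primesBelow.mpr ⟨Nat.lt_ceil.mpr hp, hpp⟩
    have hpq : (p : ℝ) ≤ q := by exact_mod_cast Finset.le_max' S p hpS
    exact ⟨lt_of_le_of_lt hpq (lt_of_lt_of_le (by linarith) (le_max_right _ _)), hpp⟩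

/-! ### The main-term estimates from Lemmas 18 and 20 (Iwaniec §9) -/

/-- `s = log y / log z ≥ c` from `z^c ≤ y` (`z > 1`). [folklore] -/
theorem le_log_div_log_of_rpow_le {y z c : ℝ} (hz : 1 < z) (h : z ^ c ≤ y) :
    c ≤ Real.log y / Real.log z := by
  have hz0 : 0 < z := by linarith
  rw [le_div_iff₀ (Real.log_pos hz), ← Real.log_rpow hz0]
  exact Real.log_le_log (Real.rpow_pos_of_pos hz0 c) h

/-- `s = log y / log z > c` from `z^c < y` (`z > 1`). [folklore] -/
theorem lt_log_div_log_of_rpow_lt {y z c : ℝ} (hz : 1 < z) (h : z ^ c < y) :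
    c < Real.log y / Real.log z := by
  have hz0 : 0 < z := by linarith
  rw [lt_div_iff₀ (Real.log_pos hz), ← Real.log_rpow hz0]
  exact Real.log_lt_log (Real.rpow_pos_of_pos hz0 c) h

/-- `s' = log y / log z' ≤ c` from `y ≤ z'^c` (`z' > 1`). [folklore] -/
theorem log_div_log_le_of_le_rpow {y z c : ℝ} (hz : 1 < z) (hy : 0 < y) (h : y ≤ z ^ c) :
    Real.log y / Real.log z ≤ c := by
  have hz0 : 0 < z := by linarith
  rw [div_le_iff₀ (Real.log_pos hz), ← Real.log_rpow hz0]
  exact Real.log_le_log hy h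

/-- **Iwaniec §9, lower bound**: `Iwaniec1980_mainTerm_lower` follows from the existence of the
greatest `β`-sieve data, Lemma 18 (`Iwaniec1980_lemma18`) and Lemma 20 (`Iwaniec1980_lemma20`): by (4.2),
`S⁻(y, z) = V(z) − T⁻(y, P(z))`; for `s > β` and `s^{50} ≤ log z`,
`T⁻ ≤ V(z) s^{−κ}(T⁻_N(s) + C (log y)^{−1/3}) ≤ V(z)(1 − f(s) + C (log y)^{−1/3})`; for
`s^{50} > log z` the crude bound `BetaSieve.discT_le_of_log_le_pow` and `f ≤ 1` give the same; at
the endpoint `s = β` (where `f(β) = 0`) one replaces `z` by `z' < z` with `P(z') = P(z)`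
(`exists_lt_primesProdBelow_eq`), `β < s' ≤ β + 2`, and uses `f(s') ≥ 0`
(`IsBetaSieveSolution.lower_nonneg_of_mem_Icc`). (Iwaniec, p. 202: "Theorem 1 follows from (3.4),
(3.5), (3.7), (4.1), (4.2), (9.1), (9.2), (6.5) and (7.7).") [cite: IwaniecActaArith1980, §9] -/
theorem Iwaniec1980_mainTerm_lower_of (hex : exists_isGreatestBetaSieveData)
    (h18 : Iwaniec1980_lemma18) (h20 : Iwaniec1980_lemma20) : Iwaniec1980_mainTerm_lower := by
  intro κ hκ
  obtain ⟨⟨F, f, β, A⟩, hB⟩ := hex hκ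
  have hsol : IsBetaSieveSolution κ F f β A := hB.1
  have hβ1 : 1 ≤ β := hsol.one_le
  have hκ0 : 0 < κ := by linarith
  refine ⟨(F, f, β, A), hB, fun L => ?_⟩
  by_cases hL : 0 ≤ L
  swap
  · exact ⟨0, fun g _ hdim => absurd hdim.nonneg hL⟩
  obtain ⟨C₁, hC₁⟩ := h20 hκ (F, f, β, A) hB L
  obtain ⟨C₂, hC₂0, hC₂⟩ := BetaSieve.discT_le_of_log_le_pow hκ0 hβ1 hL
  refine ⟨max C₁ 0 + C₂, fun g hg hdim y z hz hzy => ?_⟩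
  dsimp only at hzy hC₁ ⊢
  set s := Real.log y / Real.log z with hs
  set V := BetaSieve.vprod g (primesProdBelow z) with hV
  set P := primesProdBelow z with hP
  have hz1 : 1 < z := by linarith
  have hβs : β ≤ s := le_log_div_log_of_rpow_le hz1 hzy
  have hzy' : z ≤ y := by
    have : z ^ (1 : ℝ) ≤ z ^ β := Real.rpow_le_rpow_of_exponent_le hz1.le hβ1
    rw [Real.rpow_one] at this
    exact this.trans hzy
  have hy : 0 < y := by linarith
  have hVpos : 0 < V := hdim.vprod_pos z
  have hly : 0 ≤ Real.log y ^ (-(1 / 3 : ℝ)) := Real.rpow_nonneg (Real.log_nonneg (by linarith)) _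
  have hmain := BetaSieve.mainSum_eq_vprod_sub_discT hg (squarefree_primesProdBelow z) 0 β y
  rw [pow_zero, one_mul] at hmain
  have hf1 : f s ≤ 1 := h18.lower_le_one hκ hB hβs
  rw [hmain]
  -- the degenerate case `z = 2` (`P(z) = 1`, no boundary terms)
  rcases eq_or_lt_of_le hz with hz2 | hz2
  · have hP1 : P = 1 := by rw [hP, ← hz2]; exact SieveSequence.primesProdBelow_two
    have hd : BetaSieve.discT 0 g β y P P.primeFactors.card = 0 := by
      rw [hP1, Nat.primeFactors_one, Finset.card_empty, BetaSieve.discT, Finset.sum_range_one,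
        BetaSieve.bdrySum_zero _ _ _ _ one_ne_zero]
    rw [hd, sub_zero]
    nlinarith [mul_nonneg hVpos.le (mul_nonneg (add_nonneg (le_max_right C₁ 0) hC₂0) hly)]
  -- choose `z' ≤ z` with `P(z') = P(z)` and `s' = log y / log z' ∈ (β, ∞)`, `f s ≤ f s'`
  obtain ⟨z', hz'2, hz'y, hz'β, hPz', hfz'⟩ : ∃ z' : ℝ, 2 ≤ z' ∧ z' ≤ y ∧ z' ^ β < y ∧
      primesProdBelow z' = P ∧ f s ≤ f (Real.log y / Real.log z') := by
    rcases hzy.lt_or_eq with hlt | heq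
    · exact ⟨z, hz, hzy', hlt, rfl, le_rfl⟩
    · -- endpoint `y = z^β`, `s = β`: shrink `z`
      have hsβ : s = β := by
        refine le_antisymm ?_ hβs
        exact log_div_log_le_of_le_rpow hz1 hy heq.ge
      have ht : z ^ (β / (β + 2)) < z := by
        conv_rhs => rw [← Real.rpow_one z]
        exact Real.rpow_lt_rpow_of_exponent_lt hz1 (by rw [div_lt_one (by linarith)]; linarith)
      obtain ⟨z', h2, ht', hlt, hPeq⟩ := exists_lt_primesProdBelow_eq hz2 ht
      have hz'1 : 1 < z' := by linarith
      have hz'0 : 0 < z' := by linarith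
      refine ⟨z', h2, by linarith, ?_, hPeq, ?_⟩
      · calc z' ^ β < z ^ β := Real.rpow_lt_rpow (by linarith) hlt (by linarith)
          _ = y := heq
      · -- `β < s' ≤ β + 2`, so `f s' ≥ 0 = f β = f s`
        have hs'1 : β < Real.log y / Real.log z' :=
          lt_log_div_log_of_rpow_lt hz'1 (by
            calc z' ^ β < z ^ β := Real.rpow_lt_rpow (by linarith) hlt (by linarith)
              _ = y := heq)
        have hs'2 : Real.log y / Real.log z' ≤ β + 2 := by
          refine log_div_log_le_of_le_rpow hz'1 hy ?_
          -- `y = z^β ≤ (z^{β/(β+2)})^{β+2} ≤ z'^{β+2}`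
          calc y = z ^ β := heq.symm
            _ = (z ^ (β / (β + 2))) ^ (β + 2) := by
                rw [← Real.rpow_mul (by linarith)]; congr 1; field_simp
            _ ≤ z' ^ (β + 2) :=
                Real.rpow_le_rpow (Real.rpow_nonneg (by linarith) _) ht' (by linarith)
        have hfs : f s = 0 := by rw [hsβ]; exact hsol.lower_eq β ⟨by linarith, le_rfl⟩
        rw [hfs]
        exact hsol.lower_nonneg_of_mem_Icc hκ0 ⟨hs'1.le, hs'2⟩
  -- common tail at `(y, z')`
  set s' := Real.log y / Real.log z' with hs'
  have hz'1 : 1 < z' := by linarith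
  have hβs' : β < s' := lt_log_div_log_of_rpow_lt hz'1 hz'β
  have hs'0 : 0 < s' := by linarith
  have hV' : BetaSieve.vprod g P = V := rfl
  have hsκ : 0 < s' ^ κ := Real.rpow_pos_of_pos hs'0 κ
  have hsκ' : s' ^ (-κ) ≤ 1 := by
    rw [Real.rpow_neg hs'0.le]
    exact inv_le_one_of_one_le₀ (Real.one_le_rpow (by linarith) hκ0.le)
  have hsκ0 : 0 ≤ s' ^ (-κ) := Real.rpow_nonneg hs'0.le _
  rcases le_or_gt (s' ^ 50) (Real.log z') with hcase | hcase
  · -- the range of Lemma 20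
    have h20' := (hC₁ g hg hdim y z' hz'2 hz'y hcase P.primeFactors.card).2 hz'β
    rw [hPz', hV'] at h20'
    have h18' := (h18 hκ (F, f, β, A) hB P.primeFactors.card s').2 hβs'.le
    dsimp only at h18'
    have hT0 : BetaSieve.contT 0 κ β P.primeFactors.card s' ≤ s' ^ κ * (1 - f s') := h18'
    have step : BetaSieve.discT 0 g β y P P.primeFactors.card ≤
        V * (1 - f s') + V * (max C₁ 0 * Real.log y ^ (-(1 / 3 : ℝ))) := by
      calc BetaSieve.discT 0 g β y P P.primeFactors.card
          ≤ V * s' ^ (-κ) * (BetaSieve.contT 0 κ β P.primeFactors.card s' +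
              C₁ * Real.log y ^ (-(1 / 3 : ℝ))) := h20'
        _ ≤ V * s' ^ (-κ) * (s' ^ κ * (1 - f s') + max C₁ 0 * Real.log y ^ (-(1 / 3 : ℝ))) :=
            mul_le_mul_of_nonneg_left
              (add_le_add hT0 (mul_le_mul_of_nonneg_right (le_max_left _ _) hly))
              (mul_nonneg hVpos.le hsκ0)
        _ = V * (s' ^ (-κ) * s' ^ κ) * (1 - f s') +
              V * s' ^ (-κ) * (max C₁ 0 * Real.log y ^ (-(1 / 3 : ℝ))) := by ring
        _ ≤ V * 1 * (1 - f s') + V * 1 * (max C₁ 0 * Real.log y ^ (-(1 / 3 : ℝ))) := by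
            have e1 : s' ^ (-κ) * s' ^ κ = 1 := by
              rw [Real.rpow_neg hs'0.le, inv_mul_cancel₀ hsκ.ne']
            rw [e1]
            have h1 : V * s' ^ (-κ) ≤ V * 1 := mul_le_mul_of_nonneg_left hsκ' hVpos.le
            have h2 := mul_le_mul_of_nonneg_right h1 (mul_nonneg (le_max_right C₁ 0) hly)
            linarith
        _ = _ := by ring
    nlinarith [mul_nonneg hVpos.le (mul_nonneg hC₂0 hly), mul_nonneg hVpos.le (sub_nonneg.mpr hfz')]
  · -- the crude range
    have hcr := hC₂ g hg hdim y z' hz'2 hz'y hcase.le 0 P.primeFactors.card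
    rw [hPz', hV'] at hcr
    nlinarith [mul_nonneg hVpos.le (mul_nonneg (le_max_right C₁ 0) hly),
      mul_nonneg hVpos.le (sub_nonneg.mpr hf1)]

/-- **Iwaniec §9, upper bound**: `Iwaniec1980_mainTerm_upper` follows from the existence of the
greatest `β`-sieve data, `Iwaniec1980_lemma18` and `Iwaniec1980_lemma20` (by (4.1),
`S⁺(y, z) = V(z) + T⁺(y, P(z))`, Lemma 18 extended to `(0, β + 1]`, and `F ≥ 1`; at the endpoint
`s = β − 1` one shrinks `z` to `z'` with `P(z') = P(z)`, `β − 1 < s' ≤ β + 1`, where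
`F(s') = A s'^{−κ} ≤ A s^{−κ} = F(s)`). [cite: IwaniecActaArith1980, §9] -/
theorem Iwaniec1980_mainTerm_upper_of (hex : exists_isGreatestBetaSieveData)
    (h18 : Iwaniec1980_lemma18) (h20 : Iwaniec1980_lemma20) : Iwaniec1980_mainTerm_upper := by
  intro κ hκ
  obtain ⟨⟨F, f, β, A⟩, hB⟩ := hex hκ
  have hsol : IsBetaSieveSolution κ F f β A := hB.1
  have hβ1 : 1 ≤ β := hsol.one_le
  have hA := hsol.pos
  have hκ0 : 0 < κ := by linarith
  refine ⟨(F, f, β, A), hB, fun L => ?_⟩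
  by_cases hL : 0 ≤ L
  swap
  · exact ⟨0, fun g _ hdim => absurd hdim.nonneg hL⟩
  obtain ⟨C₁, hC₁⟩ := h20 hκ (F, f, β, A) hB L
  obtain ⟨C₂, hC₂0, hC₂⟩ := BetaSieve.discT_le_of_log_le_pow hκ0 hβ1 hL
  refine ⟨max C₁ 0 + C₂, fun g hg hdim y z hz hzy hzy2 => ?_⟩
  dsimp only at hzy2 hC₁ ⊢
  set s := Real.log y / Real.log z with hs
  set V := BetaSieve.vprod g (primesProdBelow z) with hV
  set P := primesProdBelow z with hP
  have hz1 : 1 < z := by linarith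
  have hz0 : 0 < z := by linarith
  have hβs : β - 1 ≤ s := le_log_div_log_of_rpow_le hz1 hzy2
  have hs1 : 1 ≤ s :=
    le_log_div_log_of_rpow_le (y := y) (c := 1) hz1 (by rw [Real.rpow_one]; exact hzy)
  have hs0 : 0 < s := by linarith
  have hy : 0 < y := by linarith
  have hVpos : 0 < V := hdim.vprod_pos z
  have hly : 0 ≤ Real.log y ^ (-(1 / 3 : ℝ)) := Real.rpow_nonneg (Real.log_nonneg (by linarith)) _
  have hmain := BetaSieve.mainSum_eq_vprod_sub_discT hg (squarefree_primesProdBelow z) 1 β y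
  rw [pow_one, neg_mul, one_mul, sub_neg_eq_add] at hmain
  have hF1 : 1 ≤ F s := h18.one_le_upper hκ hB hs0
  rw [hmain]
  -- the degenerate case `z = 2`
  rcases eq_or_lt_of_le hz with hz2 | hz2
  · have hP1 : P = 1 := by rw [hP, ← hz2]; exact SieveSequence.primesProdBelow_two
    have hd : BetaSieve.discT 1 g β y P P.primeFactors.card = 0 := by
      rw [hP1, Nat.primeFactors_one, Finset.card_empty, BetaSieve.discT, Finset.sum_range_one,
        BetaSieve.bdrySum_zero _ _ _ _ one_ne_zero]
    rw [hd, add_zero]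
    nlinarith [mul_nonneg hVpos.le (mul_nonneg (add_nonneg (le_max_right C₁ 0) hC₂0) hly)]
  -- choose `z' ≤ z` with `P(z') = P(z)`, `s' > β - 1` and `F s' ≤ F s`
  obtain ⟨z', hz'2, hz'y, hz'β, hPz', hFz'⟩ : ∃ z' : ℝ, 2 ≤ z' ∧ z' ≤ y ∧ z' ^ (β - 1) < y ∧
      primesProdBelow z' = P ∧ F (Real.log y / Real.log z') ≤ F s := by
    rcases hzy2.lt_or_eq with hlt | heq
    · exact ⟨z, hz, hzy, hlt, rfl, le_rfl⟩
    · -- endpoint `y = z^{β-1}`, `s = β - 1 ≥ 1`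
      have hsβ : s = β - 1 := by
        refine le_antisymm ?_ hβs
        exact log_div_log_le_of_le_rpow hz1 hy heq.ge
      have hβ2 : 2 ≤ β := by linarith
      have ht : z ^ ((β - 1) / (β + 1)) < z := by
        conv_rhs => rw [← Real.rpow_one z]
        exact Real.rpow_lt_rpow_of_exponent_lt hz1 (by rw [div_lt_one (by linarith)]; linarith)
      obtain ⟨z', h2, ht', hlt, hPeq⟩ := exists_lt_primesProdBelow_eq hz2 ht
      have hz'1 : 1 < z' := by linarith
      have hlt' : z' ^ (β - 1) < y := by
        calc z' ^ (β - 1) < z ^ (β - 1) := Real.rpow_lt_rpow (by linarith) hlt (by linarith)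
          _ = y := heq
      refine ⟨z', h2, by linarith, hlt', hPeq, ?_⟩
      -- `β - 1 < s' ≤ β + 1`, so `F s' = A s'^{-κ} ≤ A s^{-κ} = F s`
      have hs'1 : β - 1 < Real.log y / Real.log z' := lt_log_div_log_of_rpow_lt hz'1 hlt'
      have hs'2 : Real.log y / Real.log z' ≤ β + 1 := by
        refine log_div_log_le_of_le_rpow hz'1 hy ?_
        calc y = z ^ (β - 1) := heq.symm
          _ = (z ^ ((β - 1) / (β + 1))) ^ (β + 1) := by
              rw [← Real.rpow_mul hz0.le]; congr 1; field_simp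
          _ ≤ z' ^ (β + 1) := Real.rpow_le_rpow (Real.rpow_nonneg hz0.le _) ht' (by linarith)
      have hs'0 : 0 < Real.log y / Real.log z' := by linarith
      rw [hsol.upper_eq _ ⟨hs'0, hs'2⟩, hsol.upper_eq s ⟨hs0, by linarith⟩]
      exact mul_le_mul_of_nonneg_left
        (Real.rpow_le_rpow_of_nonpos hs0 (by linarith) (by linarith)) hA.le
  -- common tail at `(y, z')`
  set s' := Real.log y / Real.log z' with hs'
  have hz'1 : 1 < z' := by linarith
  have hβs' : β - 1 < s' := lt_log_div_log_of_rpow_lt hz'1 hz'β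
  have hs'1 : 1 ≤ s' :=
    le_log_div_log_of_rpow_le (y := y) (c := 1) hz'1 (by rw [Real.rpow_one]; exact hz'y)
  have hs'0 : 0 < s' := by linarith
  have hV' : BetaSieve.vprod g P = V := rfl
  have hsκ : 0 < s' ^ κ := Real.rpow_pos_of_pos hs'0 κ
  have hsκ' : s' ^ (-κ) ≤ 1 := by
    rw [Real.rpow_neg hs'0.le]
    exact inv_le_one_of_one_le₀ (Real.one_le_rpow hs'1 hκ0.le)
  have hsκ0 : 0 ≤ s' ^ (-κ) := Real.rpow_nonneg hs'0.le _
  rcases le_or_gt (s' ^ 50) (Real.log z') with hcase | hcase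
  · have h20' := (hC₁ g hg hdim y z' hz'2 hz'y hcase P.primeFactors.card).1 hz'β
    rw [hPz', hV'] at h20'
    have hT0 : BetaSieve.contT 1 κ β P.primeFactors.card s' ≤ s' ^ κ * (F s' - 1) :=
      h18.upper_of_pos hκ hB P.primeFactors.card hs'0
    have hF1' : 1 ≤ F s' := h18.one_le_upper hκ hB hs'0
    have step : BetaSieve.discT 1 g β y P P.primeFactors.card ≤
        V * (F s' - 1) + V * (max C₁ 0 * Real.log y ^ (-(1 / 3 : ℝ))) := by
      calc BetaSieve.discT 1 g β y P P.primeFactors.card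
          ≤ V * s' ^ (-κ) * (BetaSieve.contT 1 κ β P.primeFactors.card s' +
              C₁ * Real.log y ^ (-(1 / 3 : ℝ))) := h20'
        _ ≤ V * s' ^ (-κ) * (s' ^ κ * (F s' - 1) + max C₁ 0 * Real.log y ^ (-(1 / 3 : ℝ))) :=
            mul_le_mul_of_nonneg_left
              (add_le_add hT0 (mul_le_mul_of_nonneg_right (le_max_left _ _) hly))
              (mul_nonneg hVpos.le hsκ0)
        _ = V * (s' ^ (-κ) * s' ^ κ) * (F s' - 1) +
              V * s' ^ (-κ) * (max C₁ 0 * Real.log y ^ (-(1 / 3 : ℝ))) := by ring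
        _ ≤ V * 1 * (F s' - 1) + V * 1 * (max C₁ 0 * Real.log y ^ (-(1 / 3 : ℝ))) := by
            have e1 : s' ^ (-κ) * s' ^ κ = 1 := by
              rw [Real.rpow_neg hs'0.le, inv_mul_cancel₀ hsκ.ne']
            rw [e1]
            have h1 : V * s' ^ (-κ) ≤ V * 1 := mul_le_mul_of_nonneg_left hsκ' hVpos.le
            have h2 := mul_le_mul_of_nonneg_right h1 (mul_nonneg (le_max_right C₁ 0) hly)
            linarith
        _ = _ := by ring
    nlinarith [mul_nonneg hVpos.le (mul_nonneg hC₂0 hly), mul_nonneg hVpos.le (sub_nonneg.mpr hFz')]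
  · have hcr := hC₂ g hg hdim y z' hz'2 hz'y hcase.le 1 P.primeFactors.card
    rw [hPz', hV'] at hcr
    nlinarith [mul_nonneg hVpos.le (mul_nonneg (le_max_right C₁ 0) hly),
      mul_nonneg hVpos.le (sub_nonneg.mpr hF1)]

/-- Hence both halves of Iwaniec's Theorem 1 (`Iwaniec1980_thm1_lower/upper`, `SieveFunctions.lean`)
and its level-of-distribution corollaries (`SieveSequence.Iwaniec1980_lower/upper`) follow from
`exists_isGreatestBetaSieveData`, `Iwaniec1980_lemma18` and `Iwaniec1980_lemma20`. [folklore] -/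
theorem Iwaniec1980_thm1_lower_of_lemmas (hex : exists_isGreatestBetaSieveData)
    (h18 : Iwaniec1980_lemma18) (h20 : Iwaniec1980_lemma20) : Iwaniec1980_thm1_lower :=
  Iwaniec1980_thm1_lower_of_mainTerm (Iwaniec1980_mainTerm_lower_of hex h18 h20)

/-- See `Iwaniec1980_thm1_lower_of_lemmas`. [folklore] -/
theorem Iwaniec1980_thm1_upper_of_lemmas (hex : exists_isGreatestBetaSieveData)
    (h18 : Iwaniec1980_lemma18) (h20 : Iwaniec1980_lemma20) : Iwaniec1980_thm1_upper :=
  Iwaniec1980_thm1_upper_of_mainTerm (Iwaniec1980_mainTerm_upper_of hex h18 h20)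

/-- See `Iwaniec1980_thm1_lower_of_lemmas`. [folklore] -/
theorem SieveSequence.Iwaniec1980_lower_of_lemmas (hex : exists_isGreatestBetaSieveData)
    (h18 : Iwaniec1980_lemma18) (h20 : Iwaniec1980_lemma20) : SieveSequence.Iwaniec1980_lower :=
  SieveSequence.Iwaniec1980_lower_of_mainTerm (Iwaniec1980_mainTerm_lower_of hex h18 h20)

/-- See `Iwaniec1980_thm1_lower_of_lemmas`. [folklore] -/
theorem SieveSequence.Iwaniec1980_upper_of_lemmas (hex : exists_isGreatestBetaSieveData)
    (h18 : Iwaniec1980_lemma18) (h20 : Iwaniec1980_lemma20) : SieveSequence.Iwaniec1980_upper :=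
  SieveSequence.Iwaniec1980_upper_of_mainTerm (Iwaniec1980_mainTerm_upper_of hex h18 h20)

end Literature.NumberTheory.Sieve
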